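import Literature.NumberTheory.NumberFields.AmbiguousClassNumberFormula
import Literature.NumberTheory.NumberFields.CMFieldArchimedeanHerbrandFactor
import Literature.NumberTheory.NumberFields.CMFieldClassGroupTwoRank
import Literature.NumberTheory.NumberFields.CMFieldTotallyPositiveUnitsNorms
import Literature.NumberTheory.NumberFields.NarrowClassGroup
import Literature.Geometry.Kaehler.ComplexTorusRealMultiplicationNarrowClassNumber
import HarnessLib

/-!
# The ambiguous class number of a CM field and the `2`-rank of `C_F` when the strict class number of
# `F⁺` is odd (Chevalley's formula for `F/F⁺`, Takagi's Satz 15; Okazaki, *Acta Arith.* 92 (2000), Lemma 17)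

Topic `NumberTheory/NumberFields`; namespace `Literature.NumberTheory.NumberFields`.  Theorem-only file (no
definition, no named fact, no `sorry`).  `K` is a CM number field, `K⁺ = maximalRealSubfield K`,
`n = [K⁺ : ℚ]`, `τ = complexConj K` (so `Gal(K/K⁺) = {1, τ}`), `A_K = {c ∈ Cl_K : τ c = c}` the ambiguous
classes, `t` the number of finite primes of `K⁺` ramified in `K`, `E = E_{K⁺} = 𝓞_{K⁺}ˣ`,
`N = N_{K/K⁺}`, `Q̃_K = [E ∩ N Kˣ : E²]` (Okazaki's `Q̃_F`, "the index of `E²_{F⁺}` in `N_{F/F⁺}F^× ∩ E_{F⁺}`"),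
`h⁺(K⁺)` the narrow (strict) class number, `G[2] = {g : g² = 1}` (`#G[2] = 2^{rank₂ G}`).

> Okazaki, §3 **Lemma 17.** "Let `F` be a CM-field and `t` the number of finite primes of `F⁺` ramified in
> `F/F⁺`.  Assume that the `2`-rank of `C⁺_{F⁺}` is zero.  Then the `2`-rank of `C_F` is `t − 1`."
> Proof (loc. cit.): "This is well known: it is summarized in Satz 15 of Takagi's fundamental paper … An
> ideal class of a CM-field `F` is called ambiguous if the complex conjugation of `F` fixes it.  Let `A_F` be
> the group of ambiguous ideal classes of `F`.  Let `Q̃_F` be the index of `E²_{F⁺}` in `N_{F/F⁺}F^× ∩ E_{F⁺}`.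
> Satz 15 evaluates the order of `A_F` … In the situation of the lemma, the quotient of indices is `1`.  On
> the other hand, the group `A_F` is isomorphic to the direct product of `ιC_{F⁺}` and `ker(2 : C_F → C_F)`.
> Here, the group `ιC_{F⁺}` is isomorphic to `C_{F⁺}` since `h_{F⁺}` is odd and `κ_F` divides `2` by
> Lemma 14.  The formula of the previous paragraph and the isomorphisms imply the lemma."

> Horie, §1 **Lemma 1.** "Let `K` be a CM-field such that `2 ∤ h_{K⁺}`.  Then (i)
> `t_K − 1 ≤ r(A_K) ≤ t_K − 1 + [K⁺ : ℚ] − r(E_{K⁺}/E*_{K⁺})`, (ii) … if `t_K = 0` or `1`."  (`A_K` the `2`-class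
> group of `K`, `r` the `2`-rank, `E*` the totally positive units; proof: "the ambiguous ideal classes for `K/K⁺` in
> `A_K` coincide with the ideal classes in `A_K` of order at most `2`.  The ambiguous class number formula (cf. Satz 13
> in Ia of [4]) therefore implies (1.1) `r(A_K) = t_K − 1 + [K⁺:ℚ] − r(E_{K⁺}/(N_{K/K⁺}(K^×) ∩ E_{K⁺}))`.  Thus (i)
> follows from `E*_{K⁺} ⊇ N_{K/K⁺}(K^×) ∩ E_{K⁺} ⊇ E²_{K⁺}`.")

Route typed here.  Chevalley's ambiguous class number formula (tree `AmbiguousClass.ambiguousClassNumberFormula`,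
Lang's Lemma 4.1) for the cyclic quadratic extension `K/K⁺`:
`#A_K · 2 · [E : E ∩ N Kˣ] = h_{K⁺} · ∏_𝔭 e_𝔭 · ∏_{v∣∞} e_v` with `∏_𝔭 e_𝔭 = 2^t` (degree `2`) and
`∏_{v∣∞} e_v = 2^n` (every real place of `K⁺` becomes complex, tree `IsCMField.archFactor_maximalRealSubfield_eq`);
`[E : E²] = 2^n` for the totally real `K⁺` (`E ≅ {±1} × ℤ^{n-1}`; tree `ComplexTorus.card_unitsModSq_eq_two_pow`)
and `E² ⊆ E ∩ N Kˣ ⊆ E` give `[E : E ∩ N Kˣ] · Q̃_K = 2^n`, whence **`#A_K · 2 = h_{K⁺} · 2^t · Q̃_K`**.  Norms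
`y ȳ` are totally positive, so `E ∩ N Kˣ ⊆ E⁺` (totally positive units); if `h⁺(K⁺)` is odd then
`E⁺ = E²` (`h⁺ = h · [E⁺ : E²]`), so `Q̃_K = 1`, `#A_K · 2 = h_{K⁺} · 2^t`, `t ≥ 1`, `#A_K = 2^{t-1} h_{K⁺}`; and
`#A_K = h_{K⁺} · #Cl_K[2]` for odd `h_{K⁺}` (tree `IsCMField.card_ambiguous_eq_classNumber_mul_card_twoTorsion_of_odd`,
the structural half of Okazaki's proof) gives **`#Cl_K[2] = 2^{t-1}`**, i.e. `rank₂ C_K = t − 1`.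

## Main results (`K : Type` a CM number field)

* `IsCMField.coe_norm_eq_mul_complexConj` — `N_G y = y ȳ` on `Kˣ`;
  `IsCMField.embedding_pos_of_unitsIncl_eq_norm` — norms from `Kˣ` lying in `K⁺` are totally positive.
* **`IsCMField.ambiguousClassNumberFormula`** — Chevalley for `K/K⁺`:
  `#A_K · 2 · [E : E ∩ N Kˣ] = h_{K⁺} · 2^t · 2^{[K⁺:ℚ]}`.
* `IsCMField.relIndex_unitsNorm_mul_relIndex_sq_eq_two_pow` — `[E : E ∩ N Kˣ] · Q̃_K = 2^{[K⁺:ℚ]}`.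
* **`IsCMField.card_ambiguous_mul_two_eq`** — **`#A_K · 2 = h_{K⁺} · 2^t · Q̃_K`** for every CM field
  (Takagi's count of the ambiguous classes in Chevalley's normalisation).
* **`IsCMField.relIndex_sq_unitsNorm_eq_one_of_odd_narrowClassNumber`** — `h⁺(K⁺)` odd ⟹ `Q̃_K = 1`
  («the quotient of indices is `1`»); `IsCMField.relIndex_unitsNorm_eq_two_pow_of_odd_narrowClassNumber` —
  `[E : E ∩ N Kˣ] = 2^{[K⁺:ℚ]}`.
* `IsCMField.card_ambiguous_mul_two_eq_of_odd_narrowClassNumber` (`#A_K · 2 = h_{K⁺} · 2^t`),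
  `IsCMField.one_le_card_ramified_of_odd_narrowClassNumber` (`t ≥ 1`: some finite prime of `K⁺` ramifies in `K`),
  **`IsCMField.card_ambiguous_eq_of_odd_narrowClassNumber`** (`#A_K = h_{K⁺} · 2^{t-1}`).
* **`IsCMField.card_twoTorsion_classGroup_eq_two_pow_of_odd_narrowClassNumber`** — **Okazaki's Lemma 17:
  `h⁺(K⁺)` odd ⟹ `#Cl_K[2] = 2^{t-1}`** (`rank₂ C_K = t − 1`); corollaries
  `IsCMField.two_pow_dvd_classNumber_of_odd_narrowClassNumber` (`2^{t-1} ∣ h_K`) and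
  `IsCMField.odd_classNumber_iff_of_odd_narrowClassNumber` (`h_K` odd ⟺ `t = 1`).
* (§4) **`IsCMField.two_pow_mul_relIndex_sq_dvd_two_mul_classNumber_div`** — **`2^t · Q̃_K ∣ 2 h⁻_K` for every CM
  field**; `IsCMField.two_pow_dvd_classNumber_div` (`t ≥ 1 ⟹ 2^{t-1} ∣ h⁻_K`),
  **`IsCMField.even_classNumber_div_of_two_le_card_ramified`** — Louboutin–Okazaki 1994, Prop. 2: «the relative
  class number of `N` is even provided that at least two prime ideals of `N⁺` ramify in `N/N⁺`»;
  `IsCMField.card_ramified_le_one_of_odd_classNumber_div` (`h⁻_K` odd ⟹ `t ≤ 1`).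
* (§5) `IsCMField.relIndex_sq_unitsNorm_dvd_card_totPosUnitsModSq` (`Q̃_K ∣ [E⁺ : E²] = #U⁺/U²`),
  `IsCMField.card_ambiguous_mul_two_dvd` (**`#A_K · 2 ∣ 2^t · h⁺(K⁺)`**, every CM field); for `h(K⁺)` odd — Horie 1994,
  Lemma 1: **`IsCMField.card_twoTorsion_mul_two_mul_relIndex_unitsNorm_eq_of_odd`** (Horie's (1.1):
  `#Cl_K[2] · 2 · [E : E ∩ N Kˣ] = 2^t · 2^{[K⁺:ℚ]}`), **`IsCMField.card_twoTorsion_classGroup_mul_two_eq_of_odd`**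
  (`#Cl_K[2] · 2 = 2^t · Q̃_K`), `IsCMField.two_pow_dvd_card_twoTorsion_classGroup_of_odd` (lower bound
  `t − 1 ≤ rank₂ Cl_K`), `IsCMField.card_twoTorsion_classGroup_mul_two_dvd_of_odd` /
  `…_mul_classNumber_dvd_of_odd` / `…_mul_card_unitSignatures_dvd_of_odd` (upper bound
  `rank₂ Cl_K ≤ t − 1 + rank₂(E⁺/E²) = t − 1 + [K⁺:ℚ] − r(E/E⁺)`); at `t = 0` (every `e = 1`):
  `IsCMField.card_twoTorsion_classGroup_mul_two_eq_relIndex_sq_of_odd_of_forall_ramificationIdxIn_eq_one`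
  (`#Cl_K[2] · 2 = Q̃_K`, so `2 ∣ Q̃_K`).

Honest column: Takagi's Satz 15 itself (Okazaki prints it as `#A_F = (Q̃_F/Q_F) · 2^{t-1} · h_{F⁺}`, with
Hasse's unit index `Q_F`) is not transcribed — the count typed here is Chevalley's, `#A_K · 2 = h_{K⁺} · 2^t · Q̃_K`,
which is what the proof of Lemma 17 uses («the quotient of indices is `1`»); `2`-ranks are expressed through
`#G[2]`; the strict `2`-rank-zero hypothesis is `Odd (narrowClassNumber K⁺)`.  The lemma «totally positive
units of `K⁺` are squares when `h⁺(K⁺)` is odd» is re-proved privately here (it is also the content of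
`HasseUnitIndexOddNarrowClassNumber.lean`, not imported).

## References

* R. Okazaki, *Inclusion of CM-fields and divisibility of relative class numbers*, Acta Arith. 92 (2000)
  319–338, §3 Lemma 17 and its proof (held `paper:doi-10-4064-aa-92-4-319-338`, p. 9). [Okazaki2000]
* K. Horie, *On CM-fields with the same maximal real subfield*, Acta Arith. 67 (1994) 219–227, §1 Lemma 1 with
  proof, formula (1.1) (held `paper:doi-10-4064-aa-67-3-219-227`, p. 2). [Horie1994]
* S. Louboutin, R. Okazaki, *Determination of all non-normal quartic CM-fields and of all non-abelian normal octic
  CM-fields with class number one*, Acta Arith. 67 (1994) 47–62, §1 Proposition 2 and its proof («We prove that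
  `2^{t−1}` divides `h*(N)`»; held `paper:doi-10-4064-aa-67-1-47-62`, pp. 4–5). [LouboutinOkazaki1994]
* T. Takagi, *Über eine Theorie des relativ Abel'schen Zahlkörpers*, J. Coll. Sci. Imp. Univ. Tokyo 41 (1920),
  Satz 14–15 (pp. 100–106), as cited by Okazaki.
* S. Lang, *Cyclotomic Fields I and II*, GTM 121 (1990), Ch. 13 §4, Lemma 4.1 (Chevalley's formula; held copy,
  PDF pp. 203–204). [Lang1990]
* L. C. Washington, *Introduction to Cyclotomic Fields*, 2nd ed. (1997), Thm. 10.3. [Washington1997]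
-/

noncomputable section

open NumberField NumberField.IsCMField IsDedekindDomain Module
open scoped nonZeroDivisors

namespace Literature.NumberTheory.NumberFields

open Literature.NumberTheory.GaloisRepresentations Literature.NumberTheory.GaloisRepresentations.Herbrand
  Literature.NumberTheory.GaloisRepresentations.MinkowskiUnit
  Literature.NumberTheory.GaloisRepresentations.CyclicNormIndex
  Literature.Geometry.Kaehler Literature.Geometry.Kaehler.ComplexTorus

/-! ### §0. Two bridges: `#E/E² = [E : E²]`, and totally positive units are squares when `h⁺` is odd -/

section Bridges

variable (F : Type*) [Field F] [NumberField F]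

omit [NumberField F] in
/-- `#(U/U²) = [U : U²]` — the tree's quotient `UnitsModSq F = U/(u ~ ε²u)` against the index of the subgroup
of squares `U² = (x ↦ x²)(U)` of `U = 𝓞_Fˣ`. [folklore] -/
private theorem card_unitsModSq_eq_index_range_powMonoidHom :
    Nat.card (UnitsModSq F) = ((powMonoidHom 2 : (𝓞 F)ˣ →* (𝓞 F)ˣ).range).index := by
  set S : Subgroup (𝓞 F)ˣ := (powMonoidHom 2 : (𝓞 F)ˣ →* (𝓞 F)ˣ).range with hS
  rw [Subgroup.index]
  symm
  refine Nat.card_congr (Equiv.ofBijective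
    (Quot.lift (fun u : (𝓞 F)ˣ => (QuotientGroup.mk u : (𝓞 F)ˣ ⧸ S)) ?_) ⟨?_, ?_⟩).symm
  · rintro _ v ⟨ε, rfl⟩
    refine QuotientGroup.eq.mpr ⟨ε⁻¹, ?_⟩
    rw [powMonoidHom_apply, mul_inv_rev, mul_right_comm, inv_mul_cancel, one_mul, inv_pow]
  · intro a b
    induction a using Quot.inductionOn with
    | h a =>
      induction b using Quot.inductionOn with
      | h b =>
        intro h
        obtain ⟨ε, hε⟩ := QuotientGroup.eq.mp h
        rw [powMonoidHom_apply] at hε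
        refine (unitsModSq_mk_eq_mk_iff F a b).mpr ⟨ε⁻¹, ?_⟩
        rw [inv_pow, hε, mul_inv_rev, inv_inv, mul_right_comm, inv_mul_cancel, one_mul]
  · intro q
    induction q using QuotientGroup.induction_on with
    | H u => exact ⟨Quot.mk _ u, rfl⟩

/-- **`[E : E²] = 2^{[F:ℚ]}` for a totally real number field `F`** (`E = 𝓞_Fˣ ≅ {±1} × ℤ^{[F:ℚ]-1}`; tree
`ComplexTorus.card_unitsModSq_eq_two_pow`). [cite: Okazaki2000, §3 Lemma 17 (proof)] -/
theorem index_range_powMonoidHom_two_units_eq_two_pow [IsTotallyReal F] :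
    ((powMonoidHom 2 : (𝓞 F)ˣ →* (𝓞 F)ˣ).range).index = 2 ^ finrank ℚ F := by
  rw [← card_unitsModSq_eq_index_range_powMonoidHom, card_unitsModSq_eq_two_pow]

/-- `h⁺(F)` odd ⟹ every totally positive unit of the totally real field `F` is the square of a unit
(`h⁺ = h · #U⁺/U²` with `#U⁺/U²` a power of `2`, hence `= 1`).  (= the theorem of
`HasseUnitIndexOddNarrowClassNumber.lean`, re-proved to keep this file independent of it.)
[cite: Okazaki2000, §3 Lemma 15 (proof, case r = 0)] -/
private theorem isSquare_of_totallyPositive_of_odd_narrowClassNumber [IsTotallyReal F]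
    (hodd : Odd (narrowClassNumber F)) (u : (𝓞 F)ˣ) (hu : ∀ σ : F →+* ℝ, 0 < σ ((u : 𝓞 F) : F)) :
    IsSquare u := by
  obtain ⟨k, -, hk⟩ := exists_card_totPosUnitsModSq_eq_two_pow (K := F)
  rw [narrowClassNumber_eq_classNumber_mul_card_totPosUnitsModSq, hk] at hodd
  have h1 : Nat.card (TotPosUnitsModSq F) = 1 := by
    have h2 : Odd (2 ^ k) := (Nat.odd_mul.mp hodd).2
    rcases Nat.eq_zero_or_pos k with h0 | hpos
    · rw [hk, h0, pow_zero]
    · exact absurd h2 (Nat.not_odd_iff_even.mpr ((Nat.even_pow' hpos.ne').mpr even_two))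
  haveI : Subsingleton (TotPosUnitsModSq F) := (Nat.card_eq_one_iff_unique.mp h1).1
  have heq : (Quot.mk _ ⟨u, hu⟩ : TotPosUnitsModSq F) = Quot.mk _ ⟨1, fun σ => by simp⟩ :=
    Subsingleton.elim _ _
  obtain ⟨ε, hε⟩ := (totPosUnitsModSq_mk_eq_mk_iff F _ _).mp heq
  refine ⟨ε, ?_⟩
  have hε' : u = ε ^ 2 * 1 := hε
  rw [hε', mul_one, pow_two]

omit [NumberField F] in
/-- `#(U⁺/U²) = [U⁺ : U²]` — the tree's quotient `TotPosUnitsModSq F` of the totally positive units modulo squares of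
units against the relative index of the squares `U²` in the subgroup `U⁺` of totally positive units of `U = 𝓞_Fˣ`
(`U⁺` written as the pull-back of `ker(sign) ≤ Fˣ`, tree `signHom`). [folklore] -/
private theorem card_totPosUnitsModSq_eq_relIndex :
    Nat.card (TotPosUnitsModSq F) = ((powMonoidHom 2 : (𝓞 F)ˣ →* (𝓞 F)ˣ).range).relIndex
      (((signHom F).ker).comap (Units.map (algebraMap (𝓞 F) F : 𝓞 F →* F))) := by
  set S : Subgroup (𝓞 F)ˣ := (powMonoidHom 2 : (𝓞 F)ˣ →* (𝓞 F)ˣ).range with hS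
  set P : Subgroup (𝓞 F)ˣ := ((signHom F).ker).comap (Units.map (algebraMap (𝓞 F) F : 𝓞 F →* F)) with hP
  have hmemP : ∀ u : (𝓞 F)ˣ, u ∈ P ↔ ∀ σ : F →+* ℝ, 0 < σ ((u : 𝓞 F) : F) := fun u => by
    rw [hP, Subgroup.mem_comap, mem_ker_signHom_iff]; rfl
  rw [Subgroup.relIndex, Subgroup.index]
  symm
  refine Nat.card_congr (Equiv.ofBijective
    (Quot.lift (fun u : {u : (𝓞 F)ˣ // ∀ σ : F →+* ℝ, 0 < σ ((u : 𝓞 F) : F)} =>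
      (QuotientGroup.mk ⟨u.1, (hmemP u.1).mpr u.2⟩ : P ⧸ S.subgroupOf P)) ?_) ⟨?_, ?_⟩).symm
  · rintro ⟨u, hu⟩ ⟨v, hv⟩ ⟨ε, hε⟩
    refine QuotientGroup.eq.mpr (Subgroup.mem_subgroupOf.mpr ⟨ε⁻¹, ?_⟩)
    change ε⁻¹ ^ 2 = u⁻¹ * v
    rw [show u = ε ^ 2 * v from hε, mul_inv_rev, mul_right_comm, inv_mul_cancel, one_mul, inv_pow]
  · intro a b
    induction a using Quot.inductionOn with
    | h a =>
      induction b using Quot.inductionOn with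
      | h b =>
        intro h
        obtain ⟨ε, hε⟩ := Subgroup.mem_subgroupOf.mp (QuotientGroup.eq.mp h)
        rw [powMonoidHom_apply] at hε
        change ε ^ 2 = a.1⁻¹ * b.1 at hε
        refine (totPosUnitsModSq_mk_eq_mk_iff F a b).mpr ⟨ε⁻¹, ?_⟩
        rw [inv_pow, hε, mul_inv_rev, inv_inv, mul_right_comm, inv_mul_cancel, one_mul]
  · intro q
    induction q using QuotientGroup.induction_on with
    | H u => exact ⟨Quot.mk _ ⟨u.1, (hmemP u.1).mp u.2⟩, rfl⟩

end Bridges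

/-! ### §1. Chevalley's formula for `K/K⁺` -/

section Chevalley

variable (K : Type) [Field K] [NumberField K] [IsCMField K]

/-- Every element of `Gal(K/K⁺)` is a power of the complex conjugation (Mathlib `zpowers_complexConj_eq_top`).
[folklore] -/
private theorem IsCMField.mem_zpowers_complexConj (τ : K ≃ₐ[maximalRealSubfield K] K) :
    τ ∈ Subgroup.zpowers (complexConj K) := by
  rw [zpowers_complexConj_eq_top]; exact Subgroup.mem_top τ

/-- `#Gal(K/K⁺) = 2`. [folklore] -/
private theorem IsCMField.card_algEquiv_eq_two : Fintype.card (K ≃ₐ[maximalRealSubfield K] K) = 2 := by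
  rw [← Nat.card_eq_fintype_card, IsGalois.card_aut_eq_finrank,
    (IsCMField.isQuadraticExtension K).finrank_eq_two]

/-- The classes fixed by `Gal(K/K⁺)` are the classes fixed by complex conjugation: the ambiguous classes `A_K`
(«an ideal class of a CM-field `F` is called ambiguous if the complex conjugation of `F` fixes it»).
[cite: Okazaki2000, §3 Lemma 17 (proof)] -/
theorem IsCMField.card_fixed_eq_card_ambiguous :
    Nat.card {c : ClassGroup (𝓞 K) //
        ∀ τ : K ≃ₐ[maximalRealSubfield K] K, ClassGroup.mulEquiv (AmbiguousClass.intAut τ) c = c} =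
      Nat.card {c : ClassGroup (𝓞 K) //
        ClassGroup.mulEquiv (AmbiguousClass.intAut (complexConj K)) c = c} := by
  refine Nat.card_congr (Equiv.subtypeEquivRight fun c => ⟨fun h => h _, fun h τ => ?_⟩)
  obtain ⟨k, rfl⟩ := Herbrand.exists_pow_eq_of_forall_mem_zpowers (IsCMField.mem_zpowers_complexConj K) τ
  induction k with
  | zero => rw [pow_zero, AmbiguousClass.mulEquiv_intAut_one, MulEquiv.refl_apply]
  | succ k ih => rw [pow_succ, AmbiguousClass.mulEquiv_intAut_mul, MulEquiv.trans_apply, h, ih]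

/-- `∏_𝔭 e_𝔭(K/K⁺) = 2^t`, `t` the number of finite primes of `K⁺` ramified in `K` (degree `2`: a ramified prime is
totally ramified). [cite: Okazaki2000, §3 Lemma 17 (proof)] -/
theorem IsCMField.finprod_ramificationIdxIn_eq_two_pow :
    (∏ᶠ v : HeightOneSpectrum (𝓞 (maximalRealSubfield K)), v.asIdeal.ramificationIdxIn (𝓞 K)) =
      2 ^ {v : HeightOneSpectrum (𝓞 (maximalRealSubfield K)) | v.asIdeal.ramificationIdxIn (𝓞 K) ≠ 1}.ncard :=
  AmbiguousClass.finprod_ramificationIdxIn_eq_pow_of_prime Nat.prime_two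
    (IsCMField.isQuadraticExtension K).finrank_eq_two

/-- **Chevalley's ambiguous class number formula for the quadratic extension `K/K⁺` of a CM field:
`#A_K · 2 · [E_{K⁺} : E_{K⁺} ∩ N_{K/K⁺} Kˣ] = h_{K⁺} · 2^t · 2^{[K⁺:ℚ]}`** — Lang's Lemma 4.1 with `[K:K⁺] = 2`,
`∏_𝔭 e_𝔭 = 2^t` and `∏_{v∣∞} e_v = 2^{[K⁺:ℚ]}` (all real places of `K⁺` ramify in `K`).  As in
`AmbiguousClassNumberFormula.lean`, `E_{K⁺}` and `N Kˣ` are taken inside `Kˣ`: `E_{K⁺} = 𝓞_Kˣ ∩ K⁺ˣ`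
(`unitsE K ⊓ range (K⁺ˣ → Kˣ)`), `N Kˣ = N_G(Kˣ)` (`Herbrand.norm`). [cite: Okazaki2000, §3 Lemma 17 (proof)]
[cite: Lang1990, Ch. 13 §4, Lemma 4.1 (PDF pp. 203–204)] -/
theorem IsCMField.ambiguousClassNumberFormula :
    Nat.card {c : ClassGroup (𝓞 K) // ClassGroup.mulEquiv (AmbiguousClass.intAut (complexConj K)) c = c} *
        2 * (unitsE K ⊓ (⊤ : Subgroup Kˣ).map (Herbrand.norm (K ≃ₐ[maximalRealSubfield K] K))).relIndex
          (unitsE K ⊓ (unitsIncl (maximalRealSubfield K) K).range) =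
      classNumber (maximalRealSubfield K) *
        2 ^ {v : HeightOneSpectrum (𝓞 (maximalRealSubfield K)) | v.asIdeal.ramificationIdxIn (𝓞 K) ≠ 1}.ncard *
        2 ^ finrank ℚ (maximalRealSubfield K) := by
  have h := AmbiguousClass.ambiguousClassNumberFormula (K := maximalRealSubfield K) (L := K)
    (σ := complexConj K) (IsCMField.mem_zpowers_complexConj K)
  rwa [IsCMField.card_fixed_eq_card_ambiguous, (IsCMField.isQuadraticExtension K).finrank_eq_two,
    IsCMField.finprod_ramificationIdxIn_eq_two_pow, IsCMField.archFactor_maximalRealSubfield_eq] at h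

end Chevalley

/-! ### §2. The unit norm index: `[E : E ∩ N Kˣ] · Q̃_K = 2^{[K⁺:ℚ]}`; norms are totally positive -/

section UnitIndex

variable (K : Type) [Field K] [NumberField K] [IsCMField K]

/-- `N_G y = y · ȳ` on `Kˣ` (`G = Gal(K/K⁺) = {1, τ}`). [cite: Okazaki2000, §3 Lemma 17 (proof)] -/
theorem IsCMField.coe_norm_eq_mul_complexConj (y : Kˣ) :
    ((Herbrand.norm (K ≃ₐ[maximalRealSubfield K] K) y : Kˣ) : K) = (y : K) * complexConj K (y : K) := by
  classical
  rw [Herbrand.norm_apply, IsCMField.univ_algEquiv_eq_pair K,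
    Finset.prod_pair (Ne.symm (complexConj_ne_one K)), one_smul, Units.val_mul, coe_smul_units]

/-- **Norms are totally positive**: if `c ∈ K⁺ˣ` is a norm, `c = N_{K/K⁺} y = y ȳ` with `y ∈ Kˣ`, then
`σ(c) > 0` for every real embedding `σ` of `K⁺` (extend `σ` to `φ : K → ℂ`; `σ(c) = φ(y)\overline{φ(y)} = |φ(y)|²`).
[cite: Okazaki2000, §3 Lemma 17 (proof)] -/
theorem IsCMField.embedding_pos_of_unitsIncl_eq_norm {c : (maximalRealSubfield K)ˣ} {y : Kˣ}
    (h : unitsIncl (maximalRealSubfield K) K c = Herbrand.norm (K ≃ₐ[maximalRealSubfield K] K) y)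
    (σ : maximalRealSubfield K →+* ℝ) : 0 < σ (c : maximalRealSubfield K) := by
  set φ : K →+* ℂ := ComplexEmbedding.lift K (Complex.ofRealHom.comp σ) with hφdef
  have h1 : φ (algebraMap (maximalRealSubfield K) K (c : maximalRealSubfield K)) =
      ((σ (c : maximalRealSubfield K) : ℝ) : ℂ) := by
    rw [hφdef, ComplexEmbedding.lift_algebraMap_apply]; rfl
  have h2 : algebraMap (maximalRealSubfield K) K (c : maximalRealSubfield K) =
      (y : K) * complexConj K (y : K) := by
    rw [← coe_unitsIncl (L := K), h, IsCMField.coe_norm_eq_mul_complexConj]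
  rw [h2, map_mul, complexEmbedding_complexConj K φ, Complex.mul_conj] at h1
  have hy0 : φ (y : K) ≠ 0 := (map_ne_zero φ).mpr y.ne_zero
  have hre := congrArg Complex.re h1
  simp only [Complex.ofReal_re] at hre
  rw [← hre]
  exact Complex.normSq_pos.mpr hy0

/-- `j(E_{K⁺}) = 𝓞_Kˣ ∩ K⁺ˣ` inside `Kˣ`: a unit of `𝓞_K` lying in `K⁺` is a unit of `𝓞_{K⁺}` (Mathlib
`IsCMField.Units.complexConj_eq_self_iff`). [folklore] -/
private theorem range_unitsInclComp_eq :
    ((unitsIncl (maximalRealSubfield K) K).comp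
      (Units.map (algebraMap (𝓞 (maximalRealSubfield K)) (maximalRealSubfield K) :
        𝓞 (maximalRealSubfield K) →* maximalRealSubfield K))).range =
      unitsE K ⊓ (unitsIncl (maximalRealSubfield K) K).range := by
  ext x
  constructor
  · rintro ⟨v, rfl⟩
    refine Subgroup.mem_inf.mpr ⟨?_, ⟨_, rfl⟩⟩
    rw [mem_unitsE_iff]
    refine ⟨Units.map (algebraMap (𝓞 (maximalRealSubfield K)) (𝓞 K) :
      𝓞 (maximalRealSubfield K) →* 𝓞 K) v, Units.ext ?_⟩
    change algebraMap (𝓞 K) K (algebraMap (𝓞 (maximalRealSubfield K)) (𝓞 K) (v : 𝓞 (maximalRealSubfield K))) =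
      algebraMap (maximalRealSubfield K) K
        (algebraMap (𝓞 (maximalRealSubfield K)) (maximalRealSubfield K) (v : 𝓞 (maximalRealSubfield K)))
    rw [← IsScalarTower.algebraMap_apply, ← IsScalarTower.algebraMap_apply]
  · intro hx
    obtain ⟨hxE, ⟨c, hc⟩⟩ := Subgroup.mem_inf.mp hx
    obtain ⟨w, hw⟩ := mem_unitsE_iff.mp hxE
    have hwK : ((w : 𝓞 K) : K) = algebraMap (maximalRealSubfield K) K (c : maximalRealSubfield K) := by
      rw [← coe_unitsIncl (L := K), hc, ← hw]; rfl
    have hfix : complexConj K ((w : 𝓞 K) : K) = (w : 𝓞 K) := by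
      rw [hwK]; exact complexConj_apply_eq_self K _
    obtain ⟨v, hv⟩ := (IsCMField.Units.complexConj_eq_self_iff K w).mp hfix
    refine ⟨v, ?_⟩
    rw [← hc]
    apply Units.ext
    change algebraMap (maximalRealSubfield K) K
        (algebraMap (𝓞 (maximalRealSubfield K)) (maximalRealSubfield K) (v : 𝓞 (maximalRealSubfield K))) =
      algebraMap (maximalRealSubfield K) K (c : maximalRealSubfield K)
    rw [← IsScalarTower.algebraMap_apply, hv]
    exact hwK

/-- **`[E : E ∩ N Kˣ] · Q̃_K = 2^{[K⁺:ℚ]}` for every CM field `K`**, where `E = E_{K⁺}`,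
`[E : E ∩ N Kˣ]` is the unit norm index of Chevalley's formula (inside `Kˣ`) and
`Q̃_K = [E ∩ N_{K/K⁺}Kˣ : E²]` is Okazaki's index, written on `𝓞_{K⁺}ˣ` as the relative index of the squares
`(x ↦ x²)(𝓞_{K⁺}ˣ)` in the subgroup of units that are norms from `Kˣ` (pulled back along
`j : 𝓞_{K⁺}ˣ → K⁺ˣ → Kˣ`): `E² ≤ E ∩ N Kˣ ≤ E` and `[E : E²] = 2^{[K⁺:ℚ]}`. [cite: Okazaki2000, §3 Lemma 17 (proof)] -/
theorem IsCMField.relIndex_unitsNorm_mul_relIndex_sq_eq_two_pow :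
    (unitsE K ⊓ (⊤ : Subgroup Kˣ).map (Herbrand.norm (K ≃ₐ[maximalRealSubfield K] K))).relIndex
          (unitsE K ⊓ (unitsIncl (maximalRealSubfield K) K).range) *
        ((powMonoidHom 2 : (𝓞 (maximalRealSubfield K))ˣ →* (𝓞 (maximalRealSubfield K))ˣ).range).relIndex
          (((⊤ : Subgroup Kˣ).map (Herbrand.norm (K ≃ₐ[maximalRealSubfield K] K))).comap
            ((unitsIncl (maximalRealSubfield K) K).comp
              (Units.map (algebraMap (𝓞 (maximalRealSubfield K)) (maximalRealSubfield K) :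
                𝓞 (maximalRealSubfield K) →* maximalRealSubfield K)))) =
      2 ^ finrank ℚ (maximalRealSubfield K) := by
  set j := (unitsIncl (maximalRealSubfield K) K).comp
    (Units.map (algebraMap (𝓞 (maximalRealSubfield K)) (maximalRealSubfield K) :
      𝓞 (maximalRealSubfield K) →* maximalRealSubfield K)) with hj
  set M : Subgroup Kˣ := (⊤ : Subgroup Kˣ).map (Herbrand.norm (K ≃ₐ[maximalRealSubfield K] K)) with hM
  set S : Subgroup (𝓞 (maximalRealSubfield K))ˣ :=
    (powMonoidHom 2 : (𝓞 (maximalRealSubfield K))ˣ →* (𝓞 (maximalRealSubfield K))ˣ).range with hS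
  -- the unit norm index as an index in `E = 𝓞_{K⁺}ˣ`
  have hidx : (unitsE K ⊓ M).relIndex (unitsE K ⊓ (unitsIncl (maximalRealSubfield K) K).range) =
      (M.comap j).index := by
    rw [← range_unitsInclComp_eq K, ← hj, MonoidHom.range_eq_map, ← Subgroup.relIndex_comap,
      Subgroup.relIndex_top_right, Subgroup.comap_inf]
    congr 1
    refine inf_eq_right.mpr fun v _ => ?_
    rw [Subgroup.mem_comap]
    exact ((range_unitsInclComp_eq K).le ⟨v, rfl⟩).1
  -- `E² ≤ E ∩ N Kˣ`: `j(ε²) = j(ε)² = N(j ε)`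
  have hle : S ≤ M.comap j := by
    rintro _ ⟨ε, rfl⟩
    rw [Subgroup.mem_comap, hM, powMonoidHom_apply, map_pow]
    refine ⟨j ε, Subgroup.mem_top _, ?_⟩
    rw [norm_eq_pow_card_of_forall_smul_eq (fun g => ?_), IsCMField.card_algEquiv_eq_two]
    rw [hj, MonoidHom.comp_apply]
    exact smul_unitsIncl g _
  rw [hidx, mul_comm, Subgroup.relIndex_mul_index hle, hS, index_range_powMonoidHom_two_units_eq_two_pow]

/-- **`#A_K · 2 = h_{K⁺} · 2^t · Q̃_K` for every CM field `K`** — the number of ambiguous ideal classes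
(Chevalley's formula for `K/K⁺` with the unit norm index evaluated: `[E : E ∩ N Kˣ] = 2^{[K⁺:ℚ]}/Q̃_K`; cf.
Takagi's Satz 15 as quoted by Okazaki).  `Q̃_K = [E_{K⁺} ∩ N_{K/K⁺}Kˣ : E_{K⁺}²]` is spelled as in
`IsCMField.relIndex_unitsNorm_mul_relIndex_sq_eq_two_pow`. [cite: Okazaki2000, §3 Lemma 17 (proof: «Satz 15
evaluates the order of A_F»)] [cite: Lang1990, Ch. 13 §4, Lemma 4.1] -/
theorem IsCMField.card_ambiguous_mul_two_eq :
    Nat.card {c : ClassGroup (𝓞 K) // ClassGroup.mulEquiv (AmbiguousClass.intAut (complexConj K)) c = c} * 2 =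
      classNumber (maximalRealSubfield K) *
        2 ^ {v : HeightOneSpectrum (𝓞 (maximalRealSubfield K)) | v.asIdeal.ramificationIdxIn (𝓞 K) ≠ 1}.ncard *
        ((powMonoidHom 2 : (𝓞 (maximalRealSubfield K))ˣ →* (𝓞 (maximalRealSubfield K))ˣ).range).relIndex
          (((⊤ : Subgroup Kˣ).map (Herbrand.norm (K ≃ₐ[maximalRealSubfield K] K))).comap
            ((unitsIncl (maximalRealSubfield K) K).comp
              (Units.map (algebraMap (𝓞 (maximalRealSubfield K)) (maximalRealSubfield K) :
                𝓞 (maximalRealSubfield K) →* maximalRealSubfield K)))) := by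
  have h1 := IsCMField.ambiguousClassNumberFormula K
  have h2 := IsCMField.relIndex_unitsNorm_mul_relIndex_sq_eq_two_pow K
  set a := Nat.card {c : ClassGroup (𝓞 K) //
    ClassGroup.mulEquiv (AmbiguousClass.intAut (complexConj K)) c = c}
  set i := (unitsE K ⊓ (⊤ : Subgroup Kˣ).map (Herbrand.norm (K ≃ₐ[maximalRealSubfield K] K))).relIndex
    (unitsE K ⊓ (unitsIncl (maximalRealSubfield K) K).range)
  set q := ((powMonoidHom 2 : (𝓞 (maximalRealSubfield K))ˣ →* (𝓞 (maximalRealSubfield K))ˣ).range).relIndex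
    (((⊤ : Subgroup Kˣ).map (Herbrand.norm (K ≃ₐ[maximalRealSubfield K] K))).comap
      ((unitsIncl (maximalRealSubfield K) K).comp
        (Units.map (algebraMap (𝓞 (maximalRealSubfield K)) (maximalRealSubfield K) :
          𝓞 (maximalRealSubfield K) →* maximalRealSubfield K))))
  have hpos : 0 < 2 ^ finrank ℚ (maximalRealSubfield K) := pow_pos two_pos _
  apply Nat.eq_of_mul_eq_mul_right hpos
  calc a * 2 * 2 ^ finrank ℚ (maximalRealSubfield K) = a * 2 * (i * q) := by rw [h2]
    _ = a * 2 * i * q := by ring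
    _ = classNumber (maximalRealSubfield K) *
        2 ^ {v : HeightOneSpectrum (𝓞 (maximalRealSubfield K)) | v.asIdeal.ramificationIdxIn (𝓞 K) ≠ 1}.ncard *
        2 ^ finrank ℚ (maximalRealSubfield K) * q := by rw [h1]
    _ = _ := by ring

end UnitIndex

/-! ### §3. `h⁺(K⁺)` odd: `Q̃_K = 1`, `#A_K = 2^{t-1} h_{K⁺}`, and Okazaki's Lemma 17 `#Cl_K[2] = 2^{t-1}` -/

section OddNarrow

variable (K : Type) [Field K] [NumberField K] [IsCMField K]

/-- **`h⁺(K⁺)` odd ⟹ `Q̃_K = 1`**: a unit of `K⁺` which is a norm from `Kˣ` is totally positive, hence a square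
when the strict class number of `K⁺` is odd; so `E ∩ N Kˣ = E²` («In the situation of the lemma, the quotient
of indices is `1`»). [cite: Okazaki2000, §3 Lemma 17 (proof)] -/
theorem IsCMField.relIndex_sq_unitsNorm_eq_one_of_odd_narrowClassNumber
    (hodd : Odd (narrowClassNumber (maximalRealSubfield K))) :
    ((powMonoidHom 2 : (𝓞 (maximalRealSubfield K))ˣ →* (𝓞 (maximalRealSubfield K))ˣ).range).relIndex
        (((⊤ : Subgroup Kˣ).map (Herbrand.norm (K ≃ₐ[maximalRealSubfield K] K))).comap
          ((unitsIncl (maximalRealSubfield K) K).comp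
            (Units.map (algebraMap (𝓞 (maximalRealSubfield K)) (maximalRealSubfield K) :
              𝓞 (maximalRealSubfield K) →* maximalRealSubfield K)))) = 1 := by
  set j := (unitsIncl (maximalRealSubfield K) K).comp
    (Units.map (algebraMap (𝓞 (maximalRealSubfield K)) (maximalRealSubfield K) :
      𝓞 (maximalRealSubfield K) →* maximalRealSubfield K)) with hj
  rw [Subgroup.relIndex_eq_one]
  intro v hv
  obtain ⟨y, -, hy⟩ := Subgroup.mem_map.mp (Subgroup.mem_comap.mp hv)
  -- `j v = N y`, so `v` is totally positive
  have hpos : ∀ σ : maximalRealSubfield K →+* ℝ,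
      0 < σ ((v : 𝓞 (maximalRealSubfield K)) : maximalRealSubfield K) := fun σ => by
    have h := IsCMField.embedding_pos_of_unitsIncl_eq_norm K
      (c := Units.map (algebraMap (𝓞 (maximalRealSubfield K)) (maximalRealSubfield K) :
        𝓞 (maximalRealSubfield K) →* maximalRealSubfield K) v) (y := y)
      (by rw [hy, hj, MonoidHom.comp_apply]) σ
    simpa only [Units.coe_map, MonoidHom.coe_coe] using h
  obtain ⟨ε, hε⟩ := isSquare_of_totallyPositive_of_odd_narrowClassNumber (maximalRealSubfield K) hodd v hpos
  exact ⟨ε, by rw [powMonoidHom_apply, pow_two, hε]⟩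

/-- **`h⁺(K⁺)` odd ⟹ `[E_{K⁺} : E_{K⁺} ∩ N_{K/K⁺}Kˣ] = 2^{[K⁺:ℚ]}`** (the unit norm index of Chevalley's formula for
`K/K⁺`). [cite: Okazaki2000, §3 Lemma 17 (proof)] -/
theorem IsCMField.relIndex_unitsNorm_eq_two_pow_of_odd_narrowClassNumber
    (hodd : Odd (narrowClassNumber (maximalRealSubfield K))) :
    (unitsE K ⊓ (⊤ : Subgroup Kˣ).map (Herbrand.norm (K ≃ₐ[maximalRealSubfield K] K))).relIndex
        (unitsE K ⊓ (unitsIncl (maximalRealSubfield K) K).range) =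
      2 ^ finrank ℚ (maximalRealSubfield K) := by
  have h := IsCMField.relIndex_unitsNorm_mul_relIndex_sq_eq_two_pow K
  rwa [IsCMField.relIndex_sq_unitsNorm_eq_one_of_odd_narrowClassNumber K hodd, mul_one] at h

/-- **`h⁺(K⁺)` odd ⟹ `#A_K · 2 = h_{K⁺} · 2^t`.** [cite: Okazaki2000, §3 Lemma 17 (proof)] -/
theorem IsCMField.card_ambiguous_mul_two_eq_of_odd_narrowClassNumber
    (hodd : Odd (narrowClassNumber (maximalRealSubfield K))) :
    Nat.card {c : ClassGroup (𝓞 K) // ClassGroup.mulEquiv (AmbiguousClass.intAut (complexConj K)) c = c} * 2 =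
      classNumber (maximalRealSubfield K) *
        2 ^ {v : HeightOneSpectrum (𝓞 (maximalRealSubfield K)) | v.asIdeal.ramificationIdxIn (𝓞 K) ≠ 1}.ncard := by
  have h := IsCMField.card_ambiguous_mul_two_eq K
  rwa [IsCMField.relIndex_sq_unitsNorm_eq_one_of_odd_narrowClassNumber K hodd, mul_one] at h

omit [IsCMField K] in
/-- `h⁺(K⁺)` odd ⟹ `h(K⁺)` odd (`h ∣ h⁺`, the narrow class group maps onto the class group).
[cite: FrohlichTaylor1990, Ch. V §1 (1.8), p. 163] -/
theorem IsCMField.odd_classNumber_maximalRealSubfield_of_odd_narrowClassNumber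
    (hodd : Odd (narrowClassNumber (maximalRealSubfield K))) :
    Odd (classNumber (maximalRealSubfield K)) :=
  Odd.of_dvd_nat hodd (classNumber_dvd_narrowClassNumber _)

/-- **`h⁺(K⁺)` odd ⟹ `t ≥ 1`: at least one finite prime of `K⁺` ramifies in `K`** (`#A_K · 2 = h_{K⁺} · 2^t` with
`h_{K⁺}` odd). [cite: Okazaki2000, §3 Lemma 17] -/
theorem IsCMField.one_le_card_ramified_of_odd_narrowClassNumber
    (hodd : Odd (narrowClassNumber (maximalRealSubfield K))) :
    1 ≤ {v : HeightOneSpectrum (𝓞 (maximalRealSubfield K)) | v.asIdeal.ramificationIdxIn (𝓞 K) ≠ 1}.ncard := by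
  by_contra h0
  have ht : {v : HeightOneSpectrum (𝓞 (maximalRealSubfield K)) |
      v.asIdeal.ramificationIdxIn (𝓞 K) ≠ 1}.ncard = 0 := by omega
  have h := IsCMField.card_ambiguous_mul_two_eq_of_odd_narrowClassNumber K hodd
  rw [ht, pow_zero, mul_one] at h
  have h2 : 2 ∣ classNumber (maximalRealSubfield K) := ⟨_, by rw [← h, mul_comm]⟩
  exact (IsCMField.odd_classNumber_maximalRealSubfield_of_odd_narrowClassNumber K hodd).not_two_dvd_nat h2

/-- **`h⁺(K⁺)` odd ⟹ `#A_K = h_{K⁺} · 2^{t-1}`** (Takagi–Chevalley's count of the ambiguous classes).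
[cite: Okazaki2000, §3 Lemma 17 (proof)] -/
theorem IsCMField.card_ambiguous_eq_of_odd_narrowClassNumber
    (hodd : Odd (narrowClassNumber (maximalRealSubfield K))) :
    Nat.card {c : ClassGroup (𝓞 K) // ClassGroup.mulEquiv (AmbiguousClass.intAut (complexConj K)) c = c} =
      classNumber (maximalRealSubfield K) *
        2 ^ ({v : HeightOneSpectrum (𝓞 (maximalRealSubfield K)) | v.asIdeal.ramificationIdxIn (𝓞 K) ≠ 1}.ncard - 1) := by
  have h := IsCMField.card_ambiguous_mul_two_eq_of_odd_narrowClassNumber K hodd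
  have ht := IsCMField.one_le_card_ramified_of_odd_narrowClassNumber K hodd
  set t := {v : HeightOneSpectrum (𝓞 (maximalRealSubfield K)) | v.asIdeal.ramificationIdxIn (𝓞 K) ≠ 1}.ncard
  have hpow : 2 ^ t = 2 ^ (t - 1) * 2 := by
    rw [← pow_succ, Nat.sub_one_add_one_eq_of_pos ht]
  rw [hpow, ← mul_assoc] at h
  exact Nat.eq_of_mul_eq_mul_right two_pos h

/-- **Okazaki's Lemma 17: if the strict class number of `K⁺` is odd, the `2`-rank of `Cl_K` is `t − 1` —
`#Cl_K[2] = 2^{t-1}`**, `t` the number of finite primes of `K⁺` ramified in `K` (`#A_K = h_{K⁺} · 2^{t-1}` against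
`#A_K = h_{K⁺} · #Cl_K[2]`, the latter from `A_K ≅ ιC_{K⁺} × Cl_K[2]`). [cite: Okazaki2000, §3 Lemma 17] -/
theorem IsCMField.card_twoTorsion_classGroup_eq_two_pow_of_odd_narrowClassNumber
    (hodd : Odd (narrowClassNumber (maximalRealSubfield K))) :
    Nat.card {c : ClassGroup (𝓞 K) // c ^ 2 = 1} =
      2 ^ ({v : HeightOneSpectrum (𝓞 (maximalRealSubfield K)) | v.asIdeal.ramificationIdxIn (𝓞 K) ≠ 1}.ncard - 1) := by
  have hodd' := IsCMField.odd_classNumber_maximalRealSubfield_of_odd_narrowClassNumber K hodd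
  have h := IsCMField.card_ambiguous_eq_of_odd_narrowClassNumber K hodd
  rw [IsCMField.card_ambiguous_eq_classNumber_mul_card_twoTorsion_of_odd K hodd'] at h
  exact Nat.eq_of_mul_eq_mul_left (classNumber_pos (maximalRealSubfield K)) h

/-- `#Cl_K[2] ∣ h_K` (the `2`-torsion is a subgroup). [folklore] -/
private theorem card_twoTorsion_classGroup_dvd_classNumber (L : Type*) [Field L] [NumberField L] :
    Nat.card {c : ClassGroup (𝓞 L) // c ^ 2 = 1} ∣ classNumber L := by
  rw [← Nat.card_congr (Equiv.subtypeEquivRight (fun c : ClassGroup (𝓞 L) => by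
      rw [MonoidHom.mem_ker, powMonoidHom_apply]) :
      ((powMonoidHom 2 : ClassGroup (𝓞 L) →* ClassGroup (𝓞 L)).ker) ≃ {c : ClassGroup (𝓞 L) // c ^ 2 = 1}),
    classNumber, ← Nat.card_eq_fintype_card]
  exact Subgroup.card_subgroup_dvd_card _

/-- **`h⁺(K⁺)` odd ⟹ `2^{t-1} ∣ h_K`** (genus theory for `K/K⁺`). [cite: Okazaki2000, §3 Lemma 17] -/
theorem IsCMField.two_pow_dvd_classNumber_of_odd_narrowClassNumber
    (hodd : Odd (narrowClassNumber (maximalRealSubfield K))) :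
    2 ^ ({v : HeightOneSpectrum (𝓞 (maximalRealSubfield K)) | v.asIdeal.ramificationIdxIn (𝓞 K) ≠ 1}.ncard - 1) ∣
      classNumber K := by
  rw [← IsCMField.card_twoTorsion_classGroup_eq_two_pow_of_odd_narrowClassNumber K hodd]
  exact card_twoTorsion_classGroup_dvd_classNumber K

/-- `#G[2] = 1` iff `#G` is odd, for a finite commutative group `G` (Cauchy). [folklore] -/
private theorem card_twoTorsion_eq_one_iff_odd_card {G : Type*} [CommGroup G] [Finite G] :
    Nat.card {g : G // g ^ 2 = 1} = 1 ↔ Odd (Nat.card G) := by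
  classical
  haveI := Fintype.ofFinite G
  constructor
  · intro h1
    by_contra hodd
    rw [Nat.not_odd_iff_even, even_iff_two_dvd, Nat.card_eq_fintype_card] at hodd
    obtain ⟨g, hg⟩ := exists_prime_orderOf_dvd_card 2 hodd
    have hg2 : g ^ 2 = 1 := by rw [← hg]; exact pow_orderOf_eq_one g
    have hg1 : g ≠ 1 := by
      intro h; rw [h, orderOf_one] at hg; exact absurd hg (by norm_num)
    haveI : Subsingleton {g : G // g ^ 2 = 1} := (Nat.card_eq_one_iff_unique.mp h1).1
    exact hg1 (congrArg Subtype.val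
      (Subsingleton.elim (⟨g, hg2⟩ : {g : G // g ^ 2 = 1}) ⟨1, one_pow 2⟩))
  · intro hodd
    have hdvd : Nat.card {g : G // g ^ 2 = 1} ∣ Nat.card G := by
      rw [← Nat.card_congr (Equiv.subtypeEquivRight (fun g : G => by
          rw [MonoidHom.mem_ker, powMonoidHom_apply]) :
          ((powMonoidHom 2 : G →* G).ker) ≃ {g : G // g ^ 2 = 1})]
      exact Subgroup.card_subgroup_dvd_card _
    haveI : Fact (Nat.Prime 2) := ⟨Nat.prime_two⟩
    have hP : IsPGroup 2 (powMonoidHom 2 : G →* G).ker := fun g => ⟨1, Subtype.ext (by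
      have hg := g.2
      rw [MonoidHom.mem_ker, powMonoidHom_apply] at hg
      rw [pow_one, Subgroup.coe_pow, Subgroup.coe_one, hg])⟩
    obtain ⟨k, hk⟩ := IsPGroup.iff_card.mp hP
    have hk' : Nat.card {g : G // g ^ 2 = 1} = 2 ^ k := by
      rw [← hk]
      exact Nat.card_congr (Equiv.subtypeEquivRight fun g => by rw [MonoidHom.mem_ker, powMonoidHom_apply])
    rw [hk'] at hdvd ⊢
    exact Nat.Coprime.eq_one_of_dvd (Nat.Coprime.pow_left k hodd.coprime_two_left) hdvd

/-- **`h⁺(K⁺)` odd ⟹ (`h_K` odd ⟺ exactly one finite prime of `K⁺` ramifies in `K`)** (`rank₂ C_K = t − 1`).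
[cite: Okazaki2000, §3 Lemma 17] -/
theorem IsCMField.odd_classNumber_iff_of_odd_narrowClassNumber
    (hodd : Odd (narrowClassNumber (maximalRealSubfield K))) :
    Odd (classNumber K) ↔
      {v : HeightOneSpectrum (𝓞 (maximalRealSubfield K)) | v.asIdeal.ramificationIdxIn (𝓞 K) ≠ 1}.ncard = 1 := by
  have ht := IsCMField.one_le_card_ramified_of_odd_narrowClassNumber K hodd
  have h := IsCMField.card_twoTorsion_classGroup_eq_two_pow_of_odd_narrowClassNumber K hodd
  have hG : Odd (classNumber K) ↔ Nat.card {c : ClassGroup (𝓞 K) // c ^ 2 = 1} = 1 := by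
    rw [card_twoTorsion_eq_one_iff_odd_card, classNumber, Nat.card_eq_fintype_card]
  rw [hG, h]
  constructor
  · intro h1
    have h0 := Nat.pow_right_injective (le_refl 2) (h1.trans (pow_zero 2).symm)
    omega
  · intro h1
    rw [h1, Nat.sub_self, pow_zero]

end OddNarrow

/-! ### §4. Every CM field: `2^t · Q̃_K ∣ 2 h⁻_K` — Louboutin–Okazaki's Proposition 2 («`2^{t-1}` divides `h*(N)`») -/

section LouboutinOkazaki

variable (K : Type) [Field K] [NumberField K] [IsCMField K]

/-- `#A_K ∣ h_K`: the ambiguous classes form a subgroup of `Cl_K` (tree `AmbiguousClass.card_fixed_dvd_classNumber`).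
[cite: Lang1990, Ch. 13 §4, Lemma 4.1 (PDF p. 203)] -/
theorem IsCMField.card_ambiguous_dvd_classNumber :
    Nat.card {c : ClassGroup (𝓞 K) // ClassGroup.mulEquiv (AmbiguousClass.intAut (complexConj K)) c = c} ∣
      classNumber K := by
  rw [← IsCMField.card_fixed_eq_card_ambiguous]
  exact AmbiguousClass.card_fixed_dvd_classNumber (K := maximalRealSubfield K)

/-- **`2^t · Q̃_K ∣ 2 · h⁻_K` for EVERY CM field `K`** (`h⁻_K = h_K/h_{K⁺}`, `t` the number of finite primes of
`K⁺` ramified in `K`, `Q̃_K = [E_{K⁺} ∩ N Kˣ : E²_{K⁺}]`): from `#A_K · 2 = h_{K⁺} · 2^t · Q̃_K` and `#A_K ∣ h_K`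
(`2 h⁻_K = [Cl_K : A_K] · 2^t · Q̃_K`).  Louboutin–Okazaki prove `2^{t-1} ∣ h*(N)` by exhibiting the classes of the
ramified primes in `Cl_N/ι Cl_{N⁺}`; this is the same count through Chevalley's formula.
[cite: LouboutinOkazaki1994, §1 Proposition 2 (proof: «We prove that 2^{t−1} divides h*(N)»)]
[cite: Okazaki2000, §3 Lemma 17 (proof)] -/
theorem IsCMField.two_pow_mul_relIndex_sq_dvd_two_mul_classNumber_div :
    2 ^ {v : HeightOneSpectrum (𝓞 (maximalRealSubfield K)) | v.asIdeal.ramificationIdxIn (𝓞 K) ≠ 1}.ncard *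
        ((powMonoidHom 2 : (𝓞 (maximalRealSubfield K))ˣ →* (𝓞 (maximalRealSubfield K))ˣ).range).relIndex
          (((⊤ : Subgroup Kˣ).map (Herbrand.norm (K ≃ₐ[maximalRealSubfield K] K))).comap
            ((unitsIncl (maximalRealSubfield K) K).comp
              (Units.map (algebraMap (𝓞 (maximalRealSubfield K)) (maximalRealSubfield K) :
                𝓞 (maximalRealSubfield K) →* maximalRealSubfield K)))) ∣
      2 * (classNumber K / classNumber (maximalRealSubfield K)) := by
  set t := {v : HeightOneSpectrum (𝓞 (maximalRealSubfield K)) | v.asIdeal.ramificationIdxIn (𝓞 K) ≠ 1}.ncard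
  set q := ((powMonoidHom 2 : (𝓞 (maximalRealSubfield K))ˣ →* (𝓞 (maximalRealSubfield K))ˣ).range).relIndex
    (((⊤ : Subgroup Kˣ).map (Herbrand.norm (K ≃ₐ[maximalRealSubfield K] K))).comap
      ((unitsIncl (maximalRealSubfield K) K).comp
        (Units.map (algebraMap (𝓞 (maximalRealSubfield K)) (maximalRealSubfield K) :
          𝓞 (maximalRealSubfield K) →* maximalRealSubfield K))))
  set a := Nat.card {c : ClassGroup (𝓞 K) //
    ClassGroup.mulEquiv (AmbiguousClass.intAut (complexConj K)) c = c}
  obtain ⟨b, hb⟩ := IsCMField.card_ambiguous_dvd_classNumber K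
  have h1 := IsCMField.card_ambiguous_mul_two_eq K
  have h2 : classNumber K / classNumber (maximalRealSubfield K) * classNumber (maximalRealSubfield K) =
      classNumber K := by
    rw [IsCMField.classNumber_div_eq_card_ker]
    exact IsCMField.card_ker_classGroupNorm_mul_card K
  refine ⟨b, Nat.eq_of_mul_eq_mul_right (classNumber_pos (maximalRealSubfield K)) ?_⟩
  calc 2 * (classNumber K / classNumber (maximalRealSubfield K)) * classNumber (maximalRealSubfield K)
        = 2 * classNumber K := by rw [mul_assoc, h2]
    _ = a * 2 * b := by rw [hb]; ring
    _ = classNumber (maximalRealSubfield K) * 2 ^ t * q * b := by rw [h1]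
    _ = 2 ^ t * q * b * classNumber (maximalRealSubfield K) := by ring

/-- **`2^{t-1} · Q̃_K ∣ h⁻_K` for every CM field with `t ≥ 1`** (sharp form of Louboutin–Okazaki's `2^{t-1} ∣ h*(N)`).
[cite: LouboutinOkazaki1994, §1 Proposition 2 (proof)] -/
theorem IsCMField.two_pow_mul_relIndex_sq_dvd_classNumber_div
    (ht : 1 ≤ {v : HeightOneSpectrum (𝓞 (maximalRealSubfield K)) | v.asIdeal.ramificationIdxIn (𝓞 K) ≠ 1}.ncard) :
    2 ^ ({v : HeightOneSpectrum (𝓞 (maximalRealSubfield K)) | v.asIdeal.ramificationIdxIn (𝓞 K) ≠ 1}.ncard - 1) *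
        ((powMonoidHom 2 : (𝓞 (maximalRealSubfield K))ˣ →* (𝓞 (maximalRealSubfield K))ˣ).range).relIndex
          (((⊤ : Subgroup Kˣ).map (Herbrand.norm (K ≃ₐ[maximalRealSubfield K] K))).comap
            ((unitsIncl (maximalRealSubfield K) K).comp
              (Units.map (algebraMap (𝓞 (maximalRealSubfield K)) (maximalRealSubfield K) :
                𝓞 (maximalRealSubfield K) →* maximalRealSubfield K)))) ∣
      classNumber K / classNumber (maximalRealSubfield K) := by
  have h := IsCMField.two_pow_mul_relIndex_sq_dvd_two_mul_classNumber_div K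
  set t := {v : HeightOneSpectrum (𝓞 (maximalRealSubfield K)) | v.asIdeal.ramificationIdxIn (𝓞 K) ≠ 1}.ncard
  have hpow : 2 ^ t = 2 * 2 ^ (t - 1) := by
    rw [← pow_succ', Nat.sub_one_add_one_eq_of_pos ht]
  rw [hpow, mul_assoc] at h
  exact Nat.dvd_of_mul_dvd_mul_left two_pos h

/-- **`2^{t-1} ∣ h⁻_K` for every CM field `K`** with `t ≥ 1` finite primes of `K⁺` ramified in `K` («We prove that
`2^{t−1}` divides `h*(N)`»). [cite: LouboutinOkazaki1994, §1 Proposition 2 (proof)] -/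
theorem IsCMField.two_pow_dvd_classNumber_div
    (ht : 1 ≤ {v : HeightOneSpectrum (𝓞 (maximalRealSubfield K)) | v.asIdeal.ramificationIdxIn (𝓞 K) ≠ 1}.ncard) :
    2 ^ ({v : HeightOneSpectrum (𝓞 (maximalRealSubfield K)) | v.asIdeal.ramificationIdxIn (𝓞 K) ≠ 1}.ncard - 1) ∣
      classNumber K / classNumber (maximalRealSubfield K) :=
  dvd_trans (dvd_mul_right _ _) (IsCMField.two_pow_mul_relIndex_sq_dvd_classNumber_div K ht)

/-- **Louboutin–Okazaki 1994, Proposition 2: the relative class number of a CM field `N` is even provided that at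
least two prime ideals of `N⁺` ramify in `N/N⁺`.** [cite: LouboutinOkazaki1994, §1 Proposition 2] -/
theorem IsCMField.even_classNumber_div_of_two_le_card_ramified
    (ht : 2 ≤ {v : HeightOneSpectrum (𝓞 (maximalRealSubfield K)) | v.asIdeal.ramificationIdxIn (𝓞 K) ≠ 1}.ncard) :
    Even (classNumber K / classNumber (maximalRealSubfield K)) := by
  have h := IsCMField.two_pow_dvd_classNumber_div K (by omega)
  refine even_iff_two_dvd.mpr (dvd_trans (dvd_pow_self 2 ?_) h)
  omega

/-- Contrapositive: **if `h⁻_K` is odd, at most one finite prime of `K⁺` ramifies in `K`** («CM-fields `N` with odd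
relative class numbers are such that only few ideals of `N⁺` ramify in the quadratic extension `N/N⁺`»).
[cite: LouboutinOkazaki1994, §1 Proposition 2] -/
theorem IsCMField.card_ramified_le_one_of_odd_classNumber_div
    (hodd : Odd (classNumber K / classNumber (maximalRealSubfield K))) :
    {v : HeightOneSpectrum (𝓞 (maximalRealSubfield K)) | v.asIdeal.ramificationIdxIn (𝓞 K) ≠ 1}.ncard ≤ 1 := by
  by_contra h
  exact (Nat.not_even_iff_odd.mpr hodd)
    (IsCMField.even_classNumber_div_of_two_le_card_ramified K (by omega))

end LouboutinOkazaki

/-! ### §5. `Q̃_K ∣ [E⁺ : E²] = h⁺(K⁺)/h(K⁺)`, `#A_K · 2 ∣ 2^t · h⁺(K⁺)`; Horie's Lemma 1 for `h(K⁺)` odd: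
`#Cl_K[2] · 2 = 2^t · Q̃_K` and `t − 1 ≤ rank₂ Cl_K ≤ t − 1 + rank₂(E⁺/E²)` -/

section Horie

variable (K : Type) [Field K] [NumberField K] [IsCMField K]

/-- **`Q̃_K ∣ [E⁺_{K⁺} : E²_{K⁺}] = #U⁺/U²`**: `E² ≤ E ∩ N Kˣ ≤ E⁺` (norms are totally positive), so Okazaki's index
`Q̃_K = [E ∩ N Kˣ : E²]` divides `[E⁺ : E²]`, the number of totally positive units of `K⁺` modulo squares (Horie:
«`E*_{K⁺} ⊇ N_{K/K⁺}(K^×) ∩ E_{K⁺} ⊇ E²_{K⁺}`»). [cite: Horie1994, §1 Lemma 1 (proof)] -/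
theorem IsCMField.relIndex_sq_unitsNorm_dvd_card_totPosUnitsModSq :
    ((powMonoidHom 2 : (𝓞 (maximalRealSubfield K))ˣ →* (𝓞 (maximalRealSubfield K))ˣ).range).relIndex
        (((⊤ : Subgroup Kˣ).map (Herbrand.norm (K ≃ₐ[maximalRealSubfield K] K))).comap
          ((unitsIncl (maximalRealSubfield K) K).comp
            (Units.map (algebraMap (𝓞 (maximalRealSubfield K)) (maximalRealSubfield K) :
              𝓞 (maximalRealSubfield K) →* maximalRealSubfield K)))) ∣
      Nat.card (TotPosUnitsModSq (maximalRealSubfield K)) := by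
  set j := (unitsIncl (maximalRealSubfield K) K).comp
    (Units.map (algebraMap (𝓞 (maximalRealSubfield K)) (maximalRealSubfield K) :
      𝓞 (maximalRealSubfield K) →* maximalRealSubfield K)) with hj
  set M : Subgroup Kˣ := (⊤ : Subgroup Kˣ).map (Herbrand.norm (K ≃ₐ[maximalRealSubfield K] K)) with hM
  set S : Subgroup (𝓞 (maximalRealSubfield K))ˣ :=
    (powMonoidHom 2 : (𝓞 (maximalRealSubfield K))ˣ →* (𝓞 (maximalRealSubfield K))ˣ).range with hS
  set P : Subgroup (𝓞 (maximalRealSubfield K))ˣ := ((signHom (maximalRealSubfield K)).ker).comap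
    (Units.map (algebraMap (𝓞 (maximalRealSubfield K)) (maximalRealSubfield K) :
      𝓞 (maximalRealSubfield K) →* maximalRealSubfield K)) with hP
  -- `E² ≤ E ∩ N Kˣ`
  have hle₁ : S ≤ M.comap j := by
    rintro _ ⟨ε, rfl⟩
    rw [Subgroup.mem_comap, hM, powMonoidHom_apply, map_pow]
    refine ⟨j ε, Subgroup.mem_top _, ?_⟩
    rw [norm_eq_pow_card_of_forall_smul_eq (fun g => ?_), IsCMField.card_algEquiv_eq_two]
    rw [hj, MonoidHom.comp_apply]
    exact smul_unitsIncl g _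
  -- `E ∩ N Kˣ ≤ E⁺`
  have hle₂ : M.comap j ≤ P := by
    intro v hv
    obtain ⟨y, -, hy⟩ := Subgroup.mem_map.mp (Subgroup.mem_comap.mp hv)
    rw [hP, Subgroup.mem_comap, mem_ker_signHom_iff]
    intro σ
    exact IsCMField.embedding_pos_of_unitsIncl_eq_norm K (y := y) (by rw [hy, hj, MonoidHom.comp_apply]) σ
  rw [card_totPosUnitsModSq_eq_relIndex, ← Subgroup.relIndex_mul_relIndex S (M.comap j) P hle₁ hle₂]
  exact dvd_mul_right _ _

/-- **`Q̃_K · h(K⁺) ∣ h⁺(K⁺)`** (`h⁺ = h · #U⁺/U²` for the totally real `K⁺`). [cite: Horie1994, §1 Lemma 1 (proof)]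
[cite: FrohlichTaylor1990, Ch. V §1 (1.12)] -/
theorem IsCMField.relIndex_sq_unitsNorm_mul_classNumber_dvd_narrowClassNumber :
    ((powMonoidHom 2 : (𝓞 (maximalRealSubfield K))ˣ →* (𝓞 (maximalRealSubfield K))ˣ).range).relIndex
        (((⊤ : Subgroup Kˣ).map (Herbrand.norm (K ≃ₐ[maximalRealSubfield K] K))).comap
          ((unitsIncl (maximalRealSubfield K) K).comp
            (Units.map (algebraMap (𝓞 (maximalRealSubfield K)) (maximalRealSubfield K) :
              𝓞 (maximalRealSubfield K) →* maximalRealSubfield K)))) *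
        classNumber (maximalRealSubfield K) ∣
      narrowClassNumber (maximalRealSubfield K) := by
  rw [narrowClassNumber_eq_classNumber_mul_card_totPosUnitsModSq, mul_comm]
  exact Nat.mul_dvd_mul_left _ (IsCMField.relIndex_sq_unitsNorm_dvd_card_totPosUnitsModSq K)

/-- **`#A_K · 2 ∣ 2^t · h⁺(K⁺)` for every CM field `K`**: the number of ambiguous classes is at most
`2^{t-1} h⁺(K⁺)` (`#A_K · 2 = h_{K⁺} · 2^t · Q̃_K` and `Q̃_K h(K⁺) ∣ h⁺(K⁺)`). [cite: Horie1994, §1 Lemma 1 (proof, (1.1))]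
[cite: Okazaki2000, §3 Lemma 17 (proof)] -/
theorem IsCMField.card_ambiguous_mul_two_dvd :
    Nat.card {c : ClassGroup (𝓞 K) // ClassGroup.mulEquiv (AmbiguousClass.intAut (complexConj K)) c = c} * 2 ∣
      2 ^ {v : HeightOneSpectrum (𝓞 (maximalRealSubfield K)) | v.asIdeal.ramificationIdxIn (𝓞 K) ≠ 1}.ncard *
        narrowClassNumber (maximalRealSubfield K) := by
  rw [IsCMField.card_ambiguous_mul_two_eq, mul_comm (classNumber _), mul_assoc]
  refine Nat.mul_dvd_mul_left _ ?_
  rw [mul_comm]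
  exact IsCMField.relIndex_sq_unitsNorm_mul_classNumber_dvd_narrowClassNumber K

/-- **Horie's (1.1), multiplicatively: for `h(K⁺)` odd, `#Cl_K[2] · 2 · [E_{K⁺} : E_{K⁺} ∩ N_{K/K⁺}Kˣ] = 2^t · 2^{[K⁺:ℚ]}`**
(«By `2 ∤ h_{K⁺}`, the ambiguous ideal classes for `K/K⁺` in `A_K` coincide with the ideal classes in `A_K` of order at
most `2`.  The ambiguous class number formula therefore implies `r(A_K) = t_K − 1 + [K⁺:ℚ] − r(E_{K⁺}/(N_{K/K⁺}(K^×) ∩ E_{K⁺}))`»,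
`A_K` the `2`-class group of `K`, `r` the `2`-rank). [cite: Horie1994, §1 Lemma 1, (1.1)] -/
theorem IsCMField.card_twoTorsion_mul_two_mul_relIndex_unitsNorm_eq_of_odd
    (hodd : Odd (classNumber (maximalRealSubfield K))) :
    Nat.card {c : ClassGroup (𝓞 K) // c ^ 2 = 1} * 2 *
        (unitsE K ⊓ (⊤ : Subgroup Kˣ).map (Herbrand.norm (K ≃ₐ[maximalRealSubfield K] K))).relIndex
          (unitsE K ⊓ (unitsIncl (maximalRealSubfield K) K).range) =
      2 ^ {v : HeightOneSpectrum (𝓞 (maximalRealSubfield K)) | v.asIdeal.ramificationIdxIn (𝓞 K) ≠ 1}.ncard *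
        2 ^ finrank ℚ (maximalRealSubfield K) := by
  have h := IsCMField.ambiguousClassNumberFormula K
  rw [IsCMField.card_ambiguous_eq_classNumber_mul_card_twoTorsion_of_odd K hodd, mul_assoc, mul_assoc,
    mul_assoc] at h
  have h' := Nat.eq_of_mul_eq_mul_left (classNumber_pos (maximalRealSubfield K)) h
  rw [← mul_assoc] at h'
  exact h'

/-- **For `h(K⁺)` odd: `#Cl_K[2] · 2 = 2^t · Q̃_K`** (Horie's (1.1) with the unit norm index evaluated,
`[E : E ∩ N Kˣ] = 2^{[K⁺:ℚ]}/Q̃_K`). [cite: Horie1994, §1 Lemma 1, (1.1)] -/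
theorem IsCMField.card_twoTorsion_classGroup_mul_two_eq_of_odd
    (hodd : Odd (classNumber (maximalRealSubfield K))) :
    Nat.card {c : ClassGroup (𝓞 K) // c ^ 2 = 1} * 2 =
      2 ^ {v : HeightOneSpectrum (𝓞 (maximalRealSubfield K)) | v.asIdeal.ramificationIdxIn (𝓞 K) ≠ 1}.ncard *
        ((powMonoidHom 2 : (𝓞 (maximalRealSubfield K))ˣ →* (𝓞 (maximalRealSubfield K))ˣ).range).relIndex
          (((⊤ : Subgroup Kˣ).map (Herbrand.norm (K ≃ₐ[maximalRealSubfield K] K))).comap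
            ((unitsIncl (maximalRealSubfield K) K).comp
              (Units.map (algebraMap (𝓞 (maximalRealSubfield K)) (maximalRealSubfield K) :
                𝓞 (maximalRealSubfield K) →* maximalRealSubfield K)))) := by
  have h := IsCMField.card_ambiguous_mul_two_eq K
  rw [IsCMField.card_ambiguous_eq_classNumber_mul_card_twoTorsion_of_odd K hodd, mul_assoc, mul_assoc] at h
  exact Nat.eq_of_mul_eq_mul_left (classNumber_pos (maximalRealSubfield K)) h

/-- **Horie's Lemma 1 (i), lower bound: for `h(K⁺)` odd and `t ≥ 1`, `t − 1 ≤ rank₂ Cl_K`, i.e. `2^{t-1} ∣ #Cl_K[2]`.**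
[cite: Horie1994, §1 Lemma 1 (i)] -/
theorem IsCMField.two_pow_dvd_card_twoTorsion_classGroup_of_odd
    (hodd : Odd (classNumber (maximalRealSubfield K)))
    (ht : 1 ≤ {v : HeightOneSpectrum (𝓞 (maximalRealSubfield K)) | v.asIdeal.ramificationIdxIn (𝓞 K) ≠ 1}.ncard) :
    2 ^ ({v : HeightOneSpectrum (𝓞 (maximalRealSubfield K)) | v.asIdeal.ramificationIdxIn (𝓞 K) ≠ 1}.ncard - 1) ∣
      Nat.card {c : ClassGroup (𝓞 K) // c ^ 2 = 1} := by
  have h := IsCMField.card_twoTorsion_classGroup_mul_two_eq_of_odd K hodd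
  set t := {v : HeightOneSpectrum (𝓞 (maximalRealSubfield K)) | v.asIdeal.ramificationIdxIn (𝓞 K) ≠ 1}.ncard
  have hpow : 2 ^ t = 2 * 2 ^ (t - 1) := by
    rw [← pow_succ', Nat.sub_one_add_one_eq_of_pos ht]
  have hdvd : 2 * 2 ^ (t - 1) ∣ 2 * Nat.card {c : ClassGroup (𝓞 K) // c ^ 2 = 1} :=
    ⟨_, by rw [mul_comm 2 (Nat.card _), h, hpow, mul_assoc]⟩
  exact Nat.dvd_of_mul_dvd_mul_left two_pos hdvd

/-- **Horie's Lemma 1 (i), upper bound: for `h(K⁺)` odd, `rank₂ Cl_K ≤ t − 1 + rank₂(E⁺_{K⁺}/E²_{K⁺})`**, i.e.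
`#Cl_K[2] · 2 ∣ 2^t · #U⁺/U²` («`r(A_K) ≤ t_K − 1 + [K⁺:ℚ] − r(E_{K⁺}/E*_{K⁺})`», `E*` the totally positive units,
`2^{[K⁺:ℚ] − r(E/E*)} = [E* : E²]`). [cite: Horie1994, §1 Lemma 1 (i)] -/
theorem IsCMField.card_twoTorsion_classGroup_mul_two_dvd_of_odd
    (hodd : Odd (classNumber (maximalRealSubfield K))) :
    Nat.card {c : ClassGroup (𝓞 K) // c ^ 2 = 1} * 2 ∣
      2 ^ {v : HeightOneSpectrum (𝓞 (maximalRealSubfield K)) | v.asIdeal.ramificationIdxIn (𝓞 K) ≠ 1}.ncard *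
        Nat.card (TotPosUnitsModSq (maximalRealSubfield K)) := by
  rw [IsCMField.card_twoTorsion_classGroup_mul_two_eq_of_odd K hodd]
  exact Nat.mul_dvd_mul_left _ (IsCMField.relIndex_sq_unitsNorm_dvd_card_totPosUnitsModSq K)

/-- The same upper bound with class numbers: **`h(K⁺)` odd ⟹ `#Cl_K[2] · 2 · h(K⁺) ∣ 2^t · h⁺(K⁺)`.**
[cite: Horie1994, §1 Lemma 1 (i)] [cite: FrohlichTaylor1990, Ch. V §1 (1.12)] -/
theorem IsCMField.card_twoTorsion_classGroup_mul_two_mul_classNumber_dvd_of_odd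
    (hodd : Odd (classNumber (maximalRealSubfield K))) :
    Nat.card {c : ClassGroup (𝓞 K) // c ^ 2 = 1} * 2 * classNumber (maximalRealSubfield K) ∣
      2 ^ {v : HeightOneSpectrum (𝓞 (maximalRealSubfield K)) | v.asIdeal.ramificationIdxIn (𝓞 K) ≠ 1}.ncard *
        narrowClassNumber (maximalRealSubfield K) := by
  rw [IsCMField.card_twoTorsion_classGroup_mul_two_eq_of_odd K hodd, mul_assoc]
  exact Nat.mul_dvd_mul_left _ (IsCMField.relIndex_sq_unitsNorm_mul_classNumber_dvd_narrowClassNumber K)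

/-- Horie's form with unit signatures: **`h(K⁺)` odd ⟹ `#Cl_K[2] · 2 · #sign(U_{K⁺}) ∣ 2^t · 2^{[K⁺:ℚ]}`**
(`#sign(U) = [E : E*] = 2^{r(E/E*)}`, so `2^{r(A_K)} ≤ 2^{t − 1 + [K⁺:ℚ] − r(E/E*)}`).
[cite: Horie1994, §1 Lemma 1 (i)] [cite: FrohlichTaylor1990, Ch. V §1 (1.12)] -/
theorem IsCMField.card_twoTorsion_classGroup_mul_two_mul_card_unitSignatures_dvd_of_odd
    (hodd : Odd (classNumber (maximalRealSubfield K))) :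
    Nat.card {c : ClassGroup (𝓞 K) // c ^ 2 = 1} * 2 *
        Nat.card ((unitsRange (maximalRealSubfield K)).map (signHom (maximalRealSubfield K))) ∣
      2 ^ {v : HeightOneSpectrum (𝓞 (maximalRealSubfield K)) | v.asIdeal.ramificationIdxIn (𝓞 K) ≠ 1}.ncard *
        2 ^ finrank ℚ (maximalRealSubfield K) := by
  have h := IsCMField.card_twoTorsion_classGroup_mul_two_dvd_of_odd K hodd
  have hsig := card_totPosUnitsModSq_mul_card_range_signVec (K := maximalRealSubfield K)
  rw [card_unitSignatures_eq_card_range_signVec, ← hsig, ← mul_assoc]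
  exact Nat.mul_dvd_mul_right h _

omit [NumberField K] [IsCMField K] in
/-- `t = 0` when every finite prime of `K⁺` has ramification index `1` in `K` (`K/K⁺` unramified at the finite primes).
[cite: Horie1994, §1 Lemma 1 (ii) (the case t_K = 0)] -/
theorem IsCMField.card_ramified_eq_zero_of_forall_ramificationIdxIn_eq_one
    (h1 : ∀ v : HeightOneSpectrum (𝓞 (maximalRealSubfield K)), v.asIdeal.ramificationIdxIn (𝓞 K) = 1) :
    {v : HeightOneSpectrum (𝓞 (maximalRealSubfield K)) | v.asIdeal.ramificationIdxIn (𝓞 K) ≠ 1}.ncard = 0 := by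
  have h : {v : HeightOneSpectrum (𝓞 (maximalRealSubfield K)) | v.asIdeal.ramificationIdxIn (𝓞 K) ≠ 1} = ∅ :=
    Set.eq_empty_iff_forall_notMem.mpr fun v hv => hv (h1 v)
  rw [h, Set.ncard_empty]

/-- **`h(K⁺)` odd and `K/K⁺` unramified at the finite primes ⟹ `#Cl_K[2] · 2 = Q̃_K`** (Horie's (1.1) at `t_K = 0`:
`r(A_K) = [K⁺:ℚ] − r(E_{K⁺}/(N_{K/K⁺}(K^×) ∩ E_{K⁺}))`); in particular `Q̃_K` is even — some unit of `K⁺` which is a norm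
from `Kˣ` is not the square of a unit. [cite: Horie1994, §1 Lemma 1, (1.1) and (ii)] -/
theorem IsCMField.card_twoTorsion_classGroup_mul_two_eq_relIndex_sq_of_odd_of_forall_ramificationIdxIn_eq_one
    (hodd : Odd (classNumber (maximalRealSubfield K)))
    (h1 : ∀ v : HeightOneSpectrum (𝓞 (maximalRealSubfield K)), v.asIdeal.ramificationIdxIn (𝓞 K) = 1) :
    Nat.card {c : ClassGroup (𝓞 K) // c ^ 2 = 1} * 2 =
      ((powMonoidHom 2 : (𝓞 (maximalRealSubfield K))ˣ →* (𝓞 (maximalRealSubfield K))ˣ).range).relIndex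
        (((⊤ : Subgroup Kˣ).map (Herbrand.norm (K ≃ₐ[maximalRealSubfield K] K))).comap
          ((unitsIncl (maximalRealSubfield K) K).comp
            (Units.map (algebraMap (𝓞 (maximalRealSubfield K)) (maximalRealSubfield K) :
              𝓞 (maximalRealSubfield K) →* maximalRealSubfield K)))) := by
  have h := IsCMField.card_twoTorsion_classGroup_mul_two_eq_of_odd K hodd
  rwa [IsCMField.card_ramified_eq_zero_of_forall_ramificationIdxIn_eq_one K h1, pow_zero, one_mul] at h

/-- `h(K⁺)` odd and `K/K⁺` unramified at the finite primes ⟹ `2 ∣ Q̃_K = [E_{K⁺} ∩ N_{K/K⁺}Kˣ : E²_{K⁺}]`.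
[cite: Horie1994, §1 Lemma 1, (1.1) and (ii)] -/
theorem IsCMField.two_dvd_relIndex_sq_of_odd_of_forall_ramificationIdxIn_eq_one
    (hodd : Odd (classNumber (maximalRealSubfield K)))
    (h1 : ∀ v : HeightOneSpectrum (𝓞 (maximalRealSubfield K)), v.asIdeal.ramificationIdxIn (𝓞 K) = 1) :
    2 ∣ ((powMonoidHom 2 : (𝓞 (maximalRealSubfield K))ˣ →* (𝓞 (maximalRealSubfield K))ˣ).range).relIndex
        (((⊤ : Subgroup Kˣ).map (Herbrand.norm (K ≃ₐ[maximalRealSubfield K] K))).comap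
          ((unitsIncl (maximalRealSubfield K) K).comp
            (Units.map (algebraMap (𝓞 (maximalRealSubfield K)) (maximalRealSubfield K) :
              𝓞 (maximalRealSubfield K) →* maximalRealSubfield K)))) :=
  Dvd.intro_left _
    (IsCMField.card_twoTorsion_classGroup_mul_two_eq_relIndex_sq_of_odd_of_forall_ramificationIdxIn_eq_one K hodd h1)

end Horie

/-! ### §6. Horie's Lemma 1 (ii): at most one finite prime ramified ⟹ `E ∩ N Kˣ = E⁺`, `Q̃_K = [E⁺ : E²]`,
and, for `h(K⁺)` odd, `#Cl_K[2] · 2 = 2^t · [E⁺ : E²]` -/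

section HorieTwo

variable (K : Type) [Field K] [NumberField K] [IsCMField K]

omit [IsCMField K] in
/-- For the Galois extension `K/K⁺` and a finite prime `v` of `K⁺`: `e(v, K/K⁺) = 1` iff `K/K⁺` is unramified at `v`
in Mathlib's sense (`Algebra.IsUnramifiedIn`; residue fields are finite, hence perfect).
[cite: NeukirchANT1999, Ch. I §8 Prop. (8.2) and §9 Prop. (9.1)] -/
theorem IsCMField.ramificationIdxIn_eq_one_iff_isUnramifiedIn [IsGalois (maximalRealSubfield K) K]
    (v : HeightOneSpectrum (𝓞 (maximalRealSubfield K))) :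
    v.asIdeal.ramificationIdxIn (𝓞 K) = 1 ↔ Algebra.IsUnramifiedIn (𝓞 K) v.asIdeal := by
  rw [Algebra.isUnramifiedIn_iff_forall_ramificationIdx_eq_one]
  constructor
  · intro h1 Q _ hQover
    haveI := hQover
    rw [← Ideal.ramificationIdxIn_eq_ramificationIdx v.asIdeal Q (K ≃ₐ[maximalRealSubfield K] K)]
    exact h1
  · intro h
    haveI := v.isMaximal
    obtain ⟨Q, hQmax, hQover⟩ :=
      Ideal.exists_maximal_ideal_liesOver_of_isIntegral (S := 𝓞 K) v.asIdeal
    haveI := hQmax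
    haveI := hQover
    rw [Ideal.ramificationIdxIn_eq_ramificationIdx v.asIdeal Q (K ≃ₐ[maximalRealSubfield K] K)]
    exact h Q hQover

/-- `t = 0` iff-free form: if `K/K⁺` is unramified at every finite prime then `t = #{v : e(v) ≠ 1} = 0`.
[cite: Horie1994, §1 Lemma 1 (ii) (the case t_K = 0)] -/
theorem IsCMField.card_ramified_eq_zero_of_forall_isUnramifiedIn
    (hunr : ∀ v : HeightOneSpectrum (𝓞 (maximalRealSubfield K)), Algebra.IsUnramifiedIn (𝓞 K) v.asIdeal) :
    {v : HeightOneSpectrum (𝓞 (maximalRealSubfield K)) | v.asIdeal.ramificationIdxIn (𝓞 K) ≠ 1}.ncard = 0 :=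
  IsCMField.card_ramified_eq_zero_of_forall_ramificationIdxIn_eq_one K fun v =>
    (IsCMField.ramificationIdxIn_eq_one_iff_isUnramifiedIn K v).2 (hunr v)

/-- `t = 1` when exactly one finite prime `v₀` of `K⁺` ramifies in `K`. [cite: Horie1994, §1 Lemma 1 (ii) (the case t_K = 1)] -/
theorem IsCMField.card_ramified_eq_one_of_isUnramifiedIn {v₀ : HeightOneSpectrum (𝓞 (maximalRealSubfield K))}
    (hv₀ : ¬ Algebra.IsUnramifiedIn (𝓞 K) v₀.asIdeal)
    (hunr : ∀ v : HeightOneSpectrum (𝓞 (maximalRealSubfield K)), v ≠ v₀ → Algebra.IsUnramifiedIn (𝓞 K) v.asIdeal) :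
    {v : HeightOneSpectrum (𝓞 (maximalRealSubfield K)) | v.asIdeal.ramificationIdxIn (𝓞 K) ≠ 1}.ncard = 1 := by
  have h : {v : HeightOneSpectrum (𝓞 (maximalRealSubfield K)) | v.asIdeal.ramificationIdxIn (𝓞 K) ≠ 1} = {v₀} := by
    ext v
    simp only [Set.mem_setOf_eq, Set.mem_singleton_iff, Ne, IsCMField.ramificationIdxIn_eq_one_iff_isUnramifiedIn]
    exact ⟨fun hv => by_contra fun hne => hv (hunr v hne), fun hv => hv ▸ hv₀⟩
  rw [h, Set.ncard_singleton]

/-- **`E_{K⁺} ∩ N_{K/K⁺}Kˣ ⊆ E⁺_{K⁺}` for every CM field**: a unit of `K⁺` which is a norm `y ȳ` from `Kˣ` is totally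
positive (`IsCMField.embedding_pos_of_unitsIncl_eq_norm`); subgroups of `𝓞_{K⁺}ˣ`, `E⁺` written as the pull-back of
`ker(sign)`. [cite: Horie1994, §1 Lemma 1 (proof: «E⁺ ⊇ N_{K/K⁺}(K^×) ∩ E_{K⁺} ⊇ E²»)] -/
theorem IsCMField.comap_unitsNorm_le_totallyPositive :
    ((⊤ : Subgroup Kˣ).map (Herbrand.norm (K ≃ₐ[maximalRealSubfield K] K))).comap
        ((unitsIncl (maximalRealSubfield K) K).comp
          (Units.map (algebraMap (𝓞 (maximalRealSubfield K)) (maximalRealSubfield K) :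
            𝓞 (maximalRealSubfield K) →* maximalRealSubfield K))) ≤
      ((signHom (maximalRealSubfield K)).ker).comap
        (Units.map (algebraMap (𝓞 (maximalRealSubfield K)) (maximalRealSubfield K) :
          𝓞 (maximalRealSubfield K) →* maximalRealSubfield K)) := by
  intro u hu
  obtain ⟨y, -, hy⟩ := Subgroup.mem_map.mp (Subgroup.mem_comap.mp hu)
  rw [Subgroup.mem_comap, mem_ker_signHom_iff]
  intro σ
  exact IsCMField.embedding_pos_of_unitsIncl_eq_norm K (y := y) (by rw [hy, MonoidHom.comp_apply]) σ

/-- **Horie, proof of Lemma 1 (ii): `E⁺_{K⁺} ⊆ N_{K/K⁺}(K^×)` when every finite prime `v ≠ v₀` of `K⁺` is unramified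
in `K`** (units are local norms at the unramified primes — O'Meara 63:16, dyadic primes included —, at `v₀` by Hilbert
reciprocity, and then global norms by Hasse's norm theorem: the tree's
`IsCMField.exists_unit_eq_mul_complexConj_of_forall_ringHom_pos`). [cite: Horie1994, §1 Lemma 1 (ii) (proof)] -/
theorem IsCMField.totallyPositive_le_comap_unitsNorm_of_isUnramifiedIn
    {v₀ : HeightOneSpectrum (𝓞 (maximalRealSubfield K))}
    (hunr : ∀ v : HeightOneSpectrum (𝓞 (maximalRealSubfield K)), v ≠ v₀ → Algebra.IsUnramifiedIn (𝓞 K) v.asIdeal) :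
    ((signHom (maximalRealSubfield K)).ker).comap
        (Units.map (algebraMap (𝓞 (maximalRealSubfield K)) (maximalRealSubfield K) :
          𝓞 (maximalRealSubfield K) →* maximalRealSubfield K)) ≤
      ((⊤ : Subgroup Kˣ).map (Herbrand.norm (K ≃ₐ[maximalRealSubfield K] K))).comap
        ((unitsIncl (maximalRealSubfield K) K).comp
          (Units.map (algebraMap (𝓞 (maximalRealSubfield K)) (maximalRealSubfield K) :
            𝓞 (maximalRealSubfield K) →* maximalRealSubfield K))) := by
  intro u hu
  have hpos : ∀ σ : maximalRealSubfield K →+* ℝ, 0 < σ ((u : 𝓞 (maximalRealSubfield K)) : maximalRealSubfield K) := by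
    rw [Subgroup.mem_comap, mem_ker_signHom_iff] at hu
    exact hu
  obtain ⟨e, he⟩ := IsCMField.exists_unit_eq_mul_complexConj_of_forall_ringHom_pos hunr u hpos
  have hu0 : algebraMap (maximalRealSubfield K) K ((u : 𝓞 (maximalRealSubfield K)) : maximalRealSubfield K) ≠ 0 :=
    (map_ne_zero _).2 (by exact_mod_cast u.ne_zero)
  have he0 : e ≠ 0 := fun h0 => hu0 (by rw [he, h0, zero_mul])
  refine Subgroup.mem_comap.2 (Subgroup.mem_map.2 ⟨Units.mk0 e he0, Subgroup.mem_top _, Units.ext ?_⟩)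
  rw [IsCMField.coe_norm_eq_mul_complexConj, Units.val_mk0, MonoidHom.comp_apply, coe_unitsIncl, ← he]
  rfl

/-- **Horie: «`E⁺_{K⁺} = N_{K/K⁺}(K^×) ∩ E_{K⁺}`» when at most one finite prime (`v₀`) of `K⁺` ramifies in `K`.**
[cite: Horie1994, §1 Lemma 1 (ii) (proof)] -/
theorem IsCMField.comap_unitsNorm_eq_totallyPositive_of_isUnramifiedIn
    {v₀ : HeightOneSpectrum (𝓞 (maximalRealSubfield K))}
    (hunr : ∀ v : HeightOneSpectrum (𝓞 (maximalRealSubfield K)), v ≠ v₀ → Algebra.IsUnramifiedIn (𝓞 K) v.asIdeal) :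
    ((⊤ : Subgroup Kˣ).map (Herbrand.norm (K ≃ₐ[maximalRealSubfield K] K))).comap
        ((unitsIncl (maximalRealSubfield K) K).comp
          (Units.map (algebraMap (𝓞 (maximalRealSubfield K)) (maximalRealSubfield K) :
            𝓞 (maximalRealSubfield K) →* maximalRealSubfield K))) =
      ((signHom (maximalRealSubfield K)).ker).comap
        (Units.map (algebraMap (𝓞 (maximalRealSubfield K)) (maximalRealSubfield K) :
          𝓞 (maximalRealSubfield K) →* maximalRealSubfield K)) :=
  le_antisymm (IsCMField.comap_unitsNorm_le_totallyPositive K)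
    (IsCMField.totallyPositive_le_comap_unitsNorm_of_isUnramifiedIn K hunr)

/-- **`Q̃_K = [E⁺_{K⁺} : E²_{K⁺}] = #(U⁺/U²)`** when at most one finite prime of `K⁺` ramifies in `K` (Okazaki's index
`Q̃_K = [E_{K⁺} ∩ N_{K/K⁺}Kˣ : E²_{K⁺}]` against the tree's `TotPosUnitsModSq K⁺`). [cite: Horie1994, §1 Lemma 1 (ii) (proof)]
[cite: Okazaki2000, §3 Lemma 17 (proof)] -/
theorem IsCMField.relIndex_sq_unitsNorm_eq_card_totPosUnitsModSq_of_isUnramifiedIn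
    {v₀ : HeightOneSpectrum (𝓞 (maximalRealSubfield K))}
    (hunr : ∀ v : HeightOneSpectrum (𝓞 (maximalRealSubfield K)), v ≠ v₀ → Algebra.IsUnramifiedIn (𝓞 K) v.asIdeal) :
    ((powMonoidHom 2 : (𝓞 (maximalRealSubfield K))ˣ →* (𝓞 (maximalRealSubfield K))ˣ).range).relIndex
        (((⊤ : Subgroup Kˣ).map (Herbrand.norm (K ≃ₐ[maximalRealSubfield K] K))).comap
          ((unitsIncl (maximalRealSubfield K) K).comp
            (Units.map (algebraMap (𝓞 (maximalRealSubfield K)) (maximalRealSubfield K) :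
              𝓞 (maximalRealSubfield K) →* maximalRealSubfield K)))) =
      Nat.card (TotPosUnitsModSq (maximalRealSubfield K)) := by
  rw [IsCMField.comap_unitsNorm_eq_totallyPositive_of_isUnramifiedIn K hunr, card_totPosUnitsModSq_eq_relIndex]

/-- **Horie 1994, Lemma 1 (ii): «`r(A_K) = t_K − 1 + [K⁺ : ℚ] − r(E_{K⁺}/E⁺_{K⁺})` if `t_K = 0` or `1`», for `2 ∤ h_{K⁺}`** —
multiplicatively, with `[E_{K⁺} : E²_{K⁺}] = 2^{[K⁺:ℚ]}`: if `h(K⁺)` is odd and every finite prime `v ≠ v₀` of `K⁺` is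
unramified in `K`, then `#Cl_K[2] · 2 = 2^t · #(E⁺_{K⁺}/E²_{K⁺})`. [cite: Horie1994, §1 Lemma 1 (ii)] -/
theorem IsCMField.card_twoTorsion_classGroup_mul_two_eq_two_pow_mul_card_totPosUnitsModSq_of_odd
    (hodd : Odd (classNumber (maximalRealSubfield K)))
    {v₀ : HeightOneSpectrum (𝓞 (maximalRealSubfield K))}
    (hunr : ∀ v : HeightOneSpectrum (𝓞 (maximalRealSubfield K)), v ≠ v₀ → Algebra.IsUnramifiedIn (𝓞 K) v.asIdeal) :
    Nat.card {c : ClassGroup (𝓞 K) // c ^ 2 = 1} * 2 =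
      2 ^ {v : HeightOneSpectrum (𝓞 (maximalRealSubfield K)) | v.asIdeal.ramificationIdxIn (𝓞 K) ≠ 1}.ncard *
        Nat.card (TotPosUnitsModSq (maximalRealSubfield K)) := by
  rw [IsCMField.card_twoTorsion_classGroup_mul_two_eq_of_odd K hodd,
    IsCMField.relIndex_sq_unitsNorm_eq_card_totPosUnitsModSq_of_isUnramifiedIn K hunr]

/-- **Lemma 1 (ii) at `t_K = 0`: `h(K⁺)` odd and `K/K⁺` unramified at every finite prime ⟹ `#Cl_K[2] · 2 = #(E⁺_{K⁺}/E²_{K⁺})`**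
(«`r(A_K) = [K⁺ : ℚ] − 1 − r(E_{K⁺}/E⁺_{K⁺})`»); with `h⁺(K⁺) = h(K⁺) · #(E⁺/E²)`: `#Cl_K[2] · 2 · h(K⁺) = h⁺(K⁺)`.
[cite: Horie1994, §1 Lemma 1 (ii)] -/
theorem IsCMField.card_twoTorsion_classGroup_mul_two_eq_card_totPosUnitsModSq_of_odd_of_forall_isUnramifiedIn
    (hodd : Odd (classNumber (maximalRealSubfield K)))
    (hunr : ∀ v : HeightOneSpectrum (𝓞 (maximalRealSubfield K)), Algebra.IsUnramifiedIn (𝓞 K) v.asIdeal) :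
    Nat.card {c : ClassGroup (𝓞 K) // c ^ 2 = 1} * 2 = Nat.card (TotPosUnitsModSq (maximalRealSubfield K)) ∧
      Nat.card {c : ClassGroup (𝓞 K) // c ^ 2 = 1} * 2 * classNumber (maximalRealSubfield K) =
        narrowClassNumber (maximalRealSubfield K) := by
  obtain ⟨p, hpbot, hp⟩ :=
    Ring.not_isField_iff_exists_prime.1 (RingOfIntegers.not_isField (maximalRealSubfield K))
  have h := IsCMField.card_twoTorsion_classGroup_mul_two_eq_two_pow_mul_card_totPosUnitsModSq_of_odd K hodd
    (v₀ := ⟨p, hp, hpbot⟩) (fun v _ => hunr v)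
  rw [IsCMField.card_ramified_eq_zero_of_forall_isUnramifiedIn K hunr, pow_zero, one_mul] at h
  refine ⟨h, ?_⟩
  rw [narrowClassNumber_eq_classNumber_mul_card_totPosUnitsModSq, h, mul_comm]

/-- **Lemma 1 (ii) at `t_K = 1`: `h(K⁺)` odd and exactly one finite prime of `K⁺` ramified in `K` ⟹
`#Cl_K[2] = #(E⁺_{K⁺}/E²_{K⁺})`** («`r(A_K) = [K⁺ : ℚ] − r(E_{K⁺}/E⁺_{K⁺})`»); equivalently `#Cl_K[2] · h(K⁺) = h⁺(K⁺)`.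
[cite: Horie1994, §1 Lemma 1 (ii)] -/
theorem IsCMField.card_twoTorsion_classGroup_eq_card_totPosUnitsModSq_of_odd_of_isUnramifiedIn
    (hodd : Odd (classNumber (maximalRealSubfield K))) {v₀ : HeightOneSpectrum (𝓞 (maximalRealSubfield K))}
    (hv₀ : ¬ Algebra.IsUnramifiedIn (𝓞 K) v₀.asIdeal)
    (hunr : ∀ v : HeightOneSpectrum (𝓞 (maximalRealSubfield K)), v ≠ v₀ → Algebra.IsUnramifiedIn (𝓞 K) v.asIdeal) :
    Nat.card {c : ClassGroup (𝓞 K) // c ^ 2 = 1} = Nat.card (TotPosUnitsModSq (maximalRealSubfield K)) ∧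
      Nat.card {c : ClassGroup (𝓞 K) // c ^ 2 = 1} * classNumber (maximalRealSubfield K) =
        narrowClassNumber (maximalRealSubfield K) := by
  have h := IsCMField.card_twoTorsion_classGroup_mul_two_eq_two_pow_mul_card_totPosUnitsModSq_of_odd K hodd hunr
  rw [IsCMField.card_ramified_eq_one_of_isUnramifiedIn K hv₀ hunr, pow_one, mul_comm (2 : ℕ)] at h
  have h' : Nat.card {c : ClassGroup (𝓞 K) // c ^ 2 = 1} = Nat.card (TotPosUnitsModSq (maximalRealSubfield K)) :=
    Nat.eq_of_mul_eq_mul_right two_pos h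
  refine ⟨h', ?_⟩
  rw [narrowClassNumber_eq_classNumber_mul_card_totPosUnitsModSq, h', mul_comm]

end HorieTwo

end Literature.NumberTheory.NumberFields

end
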